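import Mathlib
import Literature.MathematicalPhysics.QuantumFieldTheory.Balaban1983to89.B9Eq3166
import Literature.MathematicalPhysics.QuantumFieldTheory.Balaban1983to89.Beta.GaugeFixingPropagators

/-! # `Balaban1983to89.B9SectDFP` — B9 Sect. D pp. 419–420, (3.118)–(3.126): the gauge-invariant extension `Δ_π`,
# the Faddeev–Popov computation of `HB`, `G⁻¹ = Δ_π + DRD* + Q*aQ`, the identities `RD*GQ* = 0`, `QGDR = 0` and
# `HB = GQ*(QGQ*)⁻¹B` — the paper-internal bookkeeping kernel-checked over [adv1's] `B9H163` / [an2's] `Beta` vocabulary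

CITATION HEADER.  Unit `b2b-balaban-b09` (gen 14, cell pub-balaban), PAPER SUB-CELL B09 =
T. Balaban, *Propagators for lattice gauge theories in a background field*, Commun. Math. Phys. **99** (1985) 389–434
[`Balaban1985BackgroundPropagators`] (= B9).  Sect. D, p. 419 [PDF 31] and p. 420 [PDF 32] (renders
`1985-cmp99-background-propagators-p031-x2.png`, `…-p032-x2.png`, READ AS IMAGES — the Euclid text layer is unreliable;
(3.115) from p. 418 [PDF 30], `…-p030-x2.png`), verbatim:
p. 418: *"Iterating this identity we obtain finally Q_jDλ = D^{L^jη}_{Ū^j}Q′_jλ = D̄^jQ′_jλ, (3.115) where the last equality is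
a definition of the symbol D̄^j. … In particular they imply that the average QA are invariant with respect to gauge
transformations λ satisfying Q′λ = 0, i.e. λ∈N(Q′)."*
p. 419: *"We take advantage of the fact that in (3.109), and in the integral (3.112), the quadratic form is restricted to A
satisfying the gauge condition RD\*A = 0. We define a new quadratic form extending ⟨A,ΔA⟩ in a gauge invariant way to all
configurations A. It is easy to see that such an extension, which we denote by ⟨A,Δ_πA⟩, is given by the formula
e^{−(1/2)⟨A,Δ_πA⟩} = |det(Δ↾_{N(Q′)})| ∫dλ δ(Q′λ)δ_R(RD\*A − Δλ)e^{−(1/2)⟨A−Dλ,Δ(A−Dλ)⟩}, (3.118)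
where we have used the identity RD\*(A − Dλ) = RD\*A − RΔλ = RD\*A − Δλ, which holds by the definition of R and the fact
that λ∈N(Q′). Calculating the integral above we get ⟨A,Δ_πA⟩ = ⟨A − DG′RD\*A, Δ(A − DG′RD\*A)⟩. (3.119)
The quadratic form is invariant with respect to gauge transformations determined by λ∈N(Q′). This follows from the
integral formula (3.118), but also from the above explicit representation. In fact the expression A − DG′RD\*A has this
invariance property. It is obtained by gauge transforming an arbitrary configuration A to the subspace {A:RD\*A = 0}."*
… *"We replace the operator Δ by Δ_π in (3.112), and we apply the Faddeev–Popov procedure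
HB = Z⁻¹(B)∫dA δ(QA − B)δ_R(RD\*A)e^{−(1/2)⟨A,Δ_πA⟩}A · Z′⁻¹∫dλ δ(Q′λ)e^{−(1/2)‖RD\*A−Δλ‖²}
 = Z⁻¹(B)Z′⁻¹∫dA δ(QA − B)exp[−½⟨A,Δ_πA⟩ − ½‖RD\*A‖²] · ∫dλ δ(Q′λ)δ_R(RD\*A + Δλ)(A + Dλ)
 = Z⁻¹(B)Z′⁻¹|det(Δ↾_{N(Q′)})|⁻¹∫dAδ(QA − B) · exp[−½⟨A,Δ_πA⟩ − ½⟨A,DRD\*A⟩](A − DG′RD\*A) (3.121)"*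
p. 420: *"In the second equality we have used (3.115) and the condition Q′λ = 0. They imply that QA is gauge invariant with
respect to gauge transformations satisfying this condition. To calculate the last integral we have to find a minimum of
the functional A → ½⟨A,(Δ_π + DRD\*)A⟩ = ½⟨A,G⁻¹A⟩ − ½⟨B,aB⟩ (3.122) on configurations A satisfying QA = B, and G⁻¹
defined as G⁻¹ = Δ_π + DRD\* + Q\*aQ. Now this is an easy problem. We take the Lagrange function h(A,ω) =
1/2⟨A,G⁻¹A⟩ − ⟨ω,QA − B⟩, and we get the following equations for the minimum δh/δA = G⁻¹A − Q\*ω = 0, δh/δω = QA − B = 0,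
hence A = GQ\*ω, QGQ\*ω = B, ω = (QGQ\*)⁻¹B, and finally A = GQ\*(QGQ\*)⁻¹B. Making in the last integral in (3.121) a
translation to this minimum we get HB = Z̃⁻¹∫dA δ(QA)e^{−(1/2)⟨A,G⁻¹A⟩}(A + GQ\*(QGQ\*)⁻¹B − DG′RD\*A − DG′RD\*GQ\*(QGQ\*)⁻¹B)
 = GQ\*(QGQ\*)⁻¹B − DG′RD\*GQ\*(QGQ\*)⁻¹B. (3.123) We will prove that the second term in the last line vanishes. More
exactly we will prove the identities RD\*GQ\* = 0, hence QGDR = 0. (3.124) The proof is similar to the proof of the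
corresponding identities (2.34) in [4]. We write the expression RD\*GQ\* with the help of a Gaussian integral with the
covariance G, and we apply the transformations used in (3.121) in a reversed order. We have RD\*GQ\* = … = 0 (3.125)
because RD\*A = 0, and then both integrals above, in A and λ, vanish (by the symmetries A → −A, λ → −λ, and the presence
of linear terms in A and λ only). Thus the identities (3.124) are proved. They imply the formula HB = GQ\*(QGQ\*)⁻¹B. (3.126)"*

THE POINT.  Sect. D computes the `k`-th averaging operator `H` of (3.112) (the normalised Gaussian mean of `A` under
`δ(QA − B)δ_R(RD*A)e^{−½⟨A,ΔA⟩}dA`) in four moves: (i) extend the form gauge-invariantly, (3.118) ⇒ (3.119); (ii) insert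
the Faddeev–Popov unit `Z′⁻¹∫dλ δ(Q′λ)e^{−½‖RD*A−Δλ‖²}`, shift `A → A + Dλ` and integrate `λ` against `δ_R`, (3.121);
(iii) on the fibre `QA = B` the weight is the `G⁻¹`-Gaussian ((3.122)), whose mean is its constrained minimiser
`GQ*(QGQ*)⁻¹B` plus the `T = 1 − DG′RD*`-correction, (3.123); (iv) the correction dies by `RD*GQ* = 0`, (3.124)–(3.126).
Every algebraic identity and every "calculating the integral we get" step of (i)–(iv) is kernel-checked below over
abstract real matrices — the δ-functions as integrals over the constrained subspaces (tested against a test function where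
a δ in a dependent variable is evaluated, exactly as in [this lineage's] `B9Eq3166`), the normalised means as
`∫ weight·field = (∫ weight)·value` — with (3.124) DERIVED (not assumed) from [an2's] bordered-matrix identities of
`Beta.GaugeFixingPropagators` BY NAME, i.e. by the route the print itself names ((2.34) of [4]), after the hypotheses of
those identities are DISCHARGED for the paper's objects (`Ginv_eq_slice`, `piOp_mul_gauge`): [an2's] header records the
dictionary `K ↦ Δ_π`, `τ ↦ RD*`, `A ↦ 1` only as a reading (D-an2.21) and leaves *"which of Bałaban's concrete operators
satisfy KW = 0, QW = 0, IsUnit (τW).det"* open; here `W = DN` (`N` a kernel basis of `Q′`), `K = Δ_π := TᵀKT` kills `W`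
on both sides, `Q_bW = 0` is (3.115), and the rank-deficient slice `RD*` is replaced by its coordinates `τ₀ := NᵀΔD*`
(`= NᵀΔ·RD*`), `τ₀W = NᵀΔ²N` invertible, with the Gram weight `(NᵀΔ²N)⁻¹`: `τ₀ᵀ(NᵀΔ²N)⁻¹τ₀ = DRD*` EXACTLY ([g13's]
`B9SectECov.R_eq_kernelBasis`), so `G⁻¹` of (3.122) literally has [an2's] three-block shape.  The positivity of `G⁻¹` is
[adv8's] by-hand SHARPENING (GAPS C-adv8-1: `⟨A,G⁻¹A⟩ = ⟨A″,Δ_aA″⟩ + ‖RD*A‖²`, `A″ = TA`) made kernel (`Ginv_quadForm`,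
`Ginv_posDef_of_slicePos` / `Ginv_posDef_of_Δa` — v1.1, from `K + aQ_bᵀQ_b > 0` on the gauge-fixed hyperplane
`{RD*A = 0}`, resp. from the PRINT's `Δ_a = K + DRD* + Q*aQ > 0` of (3.111), p. 417; see v1.1 below).

WHAT THIS FILE CERTIFIES (kernel; finite index types: `n` sites (gauge parameters `λ`, the site Laplacian `Δ = D*D`,
`Q′ : m × n` the site averaging with kernel basis `N : n × τ`, `Q′N = 0`), `b` bonds (the variable `A`, the bond form `K`
written `⟨A,ΔA⟩` in (3.112)/(3.118), `D : b × n` with `DᵀD = Δ`), `q` the rows of the bond averaging `Q_b` (`Q_bD = D̄Q′`,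
(3.115)), `κ` coordinates of `N(Q_b)`; `R`, `G′ = (Δ + aQ′*Q′)⁻¹`, `M′` are [adv1's] `B9H163.R`, `.G'`, `.M'`):
1. §1 `constrainedMean`, `constrainedMean_map` — THE `δ(QA − B)`-CONSTRAINED GAUSSIAN MEAN IS THE CONSTRAINED MINIMISER:
   for symmetric `S` positive definite on `ker Q = Ran N`, `∫ e^{−½⟨A,SA⟩}·A = (∫ e^{−½⟨A,SA⟩})·ℋ(QA₀)` over the fibre
   `A = A₀ + Nz`, `ℋ = minOp S Q` ([an2's] `Beta.CompositionSingular.minOp`), and the same after any linear map `T`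
   (the content of *"Making … a translation to this minimum"*; [g13's] `B9SectECov.action_translation`, `mean_kernelBasis`).
2. §2 the objects: `tOp = 1 − DG′RD*` (`T`), `piOp K = TᵀKT` (`Δ_π` AS (3.119) DEFINES IT), `Ginv = Δ_π + DRD* + ab·Q_bᵀQ_b`
   ((3.122)); `R_mul_Δ_mul_G'_mul_R` (`RΔG′R = R`), `R_mul_Dt_mul_tOp`/`R_Dt_mulVec_tOp` (`RD*·T = 0`: *"gauge transforming an
   arbitrary configuration A to the subspace {A:RD\*A = 0}"*), `Qb_mulVec_tOp` (`Q_bTA = Q_bA`, by (3.115)), `tOp_mul_gauge`,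
   `tOp_mulVec_gauge` (`T(A + Dλ) = TA`, `λ ∈ N(Q′)`: *"the expression A − DG′RD\*A has this invariance property"*),
   `piOp_quadForm`, `piOp_gauge`, `piOp_mul_gauge` (`⟨A,Δ_πA⟩ = ⟨TA,K·TA⟩` is gauge invariant; `Δ_πDN = Δ_πᵀDN = 0`).
3. §3 (3.118) ⇒ (3.119) and (3.121): `eq_3118_identity` (`RD*(A − Dλ) = RD*A − Δλ`); `eq_3118` — (3.118) AT (tested)
   MEASURE LEVEL: `∫_R ψ(w)F(G′Rw)dw = |det(Δ↾_{N(Q′)})|·∫_{N(Q′)}ψ(Δλ)F(λ)dλ` for every `F`, i.e. the printed right side,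
   as a distribution in `w = RD*A ∈ R`, IS the function `F(G′Rw)` ([this lineage's] `B9Eq3166.eq_3160`); `eq_3119` (the
   exponent at `λ = G′RD*A` is `⟨A,Δ_πA⟩`); `eq_3121_Q`, `eq_3121_R`, `eq_3121_exponent` (second equality of (3.121): every
   factor under `A → A + Dλ`), `eq_3121_lambda` (third equality: the λ-integration against `δ_R(RD*A + Δλ)` at tested
   measure level, `|det(Δ↾_{N(Q′)})|⁻¹` and the field `A − DG′Rw`, = [this lineage's] `B9Eq3166.eq_3166_F`), `eq_3121_field`
   (`A − DG′R·RD*A = TA`, `R² = R`).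
4. §4 (3.122): `eq_3122` (`⟨A,(Δ_π + DRD*)A⟩ = ⟨A,G⁻¹A⟩ − a⟨B,B⟩` on `Q_bA = B`); `Ginv_quadForm`
   (`⟨A,G⁻¹A⟩ = ⟨TA,(K + aQ_bᵀQ_b)TA⟩ + ‖RD*A‖²`), `Ginv_transpose`, `Ginv_posDef` (v1: `G⁻¹ > 0` from `K + aQ_bᵀQ_b > 0`
   on ALL bond configurations — a hypothesis STRONGER than the print's and unsatisfiable whenever `K` kills the gauge modes
   `Dλ`, `λ ∈ N(Q′)`: [pv09-g9]'s cross-read finding F1, kept as a kernel-true statement only) and — **v1.1** —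
   `Ginv_posDef_of_slicePos` (`G⁻¹ > 0` from `K + aQ_bᵀQ_b > 0` on the gauge-fixed hyperplane `{A : RD*A = 0}` — the
   minimal input) and `Ginv_posDef_of_Δa` (`G⁻¹ > 0` from the PRINT's `Δ_a = K + DRD* + Q*aQ > 0`, (3.111) p. 417,
   Theorem 3.11 p. 416 — with NO perturbation argument: [adv8's] sharpening, now certified as advertised).
5. §5 (3.123)–(3.126): `lagrange_3123` (the Lagrange equations and `A = GQ*(QGQ*)⁻¹B = minOp G⁻¹ Q_b · B`, [an2's]
   `minOp_eq_minMap`); `eq_3123_weight` (on the fibre the (3.121) weight is `e^{½a‖B‖²}·e^{−½⟨A,G⁻¹A⟩}`); `eq_3123` —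
   (3.123) AS A NORMALISED MEAN: `∫ e^{−½⟨A,G⁻¹A⟩}·TA dz = (∫ e^{−½⟨A,G⁻¹A⟩}dz)·(ℋB − DG′RD*ℋB)` over the fibre
   `Q_bA = B = Q_bA₀`; `Ginv_eq_slice` (`G⁻¹ = Δ_π + Q_bᵀ(a·1)Q_b + τ₀ᵀ(NᵀΔ²N)⁻¹τ₀`); `eq_3124` — (3.124) `RD*GQ_b* = 0 ∧
   Q_bGDR = 0`, `G = (G⁻¹)⁻¹`, from [an2's] `slice_mul_inv_mul_transpose` / `mul_inv_mul_slice_transpose` BY NAME;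
   `eq_3125_lambda` (the `λ → −λ` symmetry piece of (3.125): the centred first moment over `N(Q′)` vanishes, [g13's]
   `B9SectECov.eq_3151_mean`); `eq_3126` — (3.126): `T·ℋ = ℋ` (the second term of (3.123) vanishes) and
   `ℋB = GQ_b*(Q_bGQ_b*)⁻¹B`.
WHAT IT DOES NOT CERTIFY: the normalising constants `Z(B)`, `Z′`, `Z̃` and the global Fubini / order-of-integration
bookkeeping joining (3.112) to the last member of (3.121) as ONE identity of normalised integrals (certified factor-wise:
items 3, 5; the constants cancel and are not tracked); (3.120) (= the second identity (3.117) applied to (3.119); (3.117) is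
BCH bookkeeping of [5]/B7, certified by hand in C-adv8-1, not typed) and the smallness of `Δ′_π`; the `A`-integral route
(3.125) to (3.124) (a second moment — (3.124) is certified by the bordered-matrix algebra instead, the route the print names
first); the identification of `K`, `D`, `Q_b`, `D̄`, `a` with the block-spin operators of [5] and the analytic inputs kept as
hypotheses — `Δ + aQ′*Q′` invertible (`hΔ'`), `M′` invertible (`hM'`), `NᵀΔ²N` invertible / positive (`Δ↾_{N(Q′)}` injective),
`Δ_a = K + DRD* + aQ_bᵀQ_b > 0` (`hΔa`, (3.111) p. 417 / Thm 3.11; v1.1) or just `K + aQ_bᵀQ_b > 0` on `{RD*A = 0}`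
(`hslice`; v1.1) — v1's `hKa : K + aQ_bᵀQ_b > 0` on all of `ℝ^b` is stronger than the print's and is NOT one of the paper's
inputs —, `G⁻¹` and `Q_bGQ_b*` invertible where only invertibility is used (`hG`, `hP`; `hG` follows from
`Ginv_posDef_of_Δa`); p. 421 onwards (`G₁`, `H₁`, (3.127)–(3.129), Theorem 3.12: [r1's] `B9.lean` Sect. D ring
identities, `B9SectDForm`, G-B9-15/16).
MODELLING / DIVERGENCE (recorded as D-b09.53): (a) TWO `Δ`'s — the print writes `Δ` both for the bond form of
(3.112)/(3.118) (here an arbitrary matrix `K : b × b`) and for the site Laplacian inside `R`, `G′`, `|det(Δ↾_{N(Q′)})|`,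
`‖RD*A − Δλ‖` (here `Δ : n × n` with `DᵀD = Δ`, `hD`); (b) δ-functions ↦ Lebesgue integrals over the constrained subspaces
in kernel-basis coordinates ([this lineage's] `B9Eq3166.subInt`, `δ_R` tested against `ψ`; D-b09.48), `|det(Δ↾_{N(Q′)})| ↦
B9Eq3166.absDetOn Δ N`; (c) the fibre `{Q_bA = B}` ↦ `A = A₀ + N_bz`, `B := Q_bA₀` (every `B` when `Q_bQ_bᵀ` is invertible);
(d) real entries, `*` ↦ `ᵀ`, `Q*aQ ↦ ab·Q_bᵀQ_b` (scalar `a`), `‖x‖² ↦ x ⬝ᵥ x`; (e) the slice-in-coordinates `τ₀ = NᵀΔD*` and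
weight `(NᵀΔ²N)⁻¹` instantiating [an2's] `(τ, A)` (their reading `τ ↦ RD*`, `A ↦ 1` is not typable verbatim: `τW` must be
square); (f) arbitrary finite index types, no lattice geometry; (g) — v1.1 — NO gauge invariance of `K` is assumed anywhere
in this file (`T` does the work: `Δ_π·DN = 0` by `piOp_mul_gauge` for every `K`); readers mapping `K ↦ Δ(U)` with (3.117)
lose nothing, and the positivity input is then necessarily the print's `Δ_a` (or `hslice`), never v1's `hKa`.
RECORDS: GAPS C-B9-74 (v1), C-B9-76 (v1.1); DIVERGENCE D-b09.53 (v1), D-b09.55 (v1.1).  No `sorry`, no new axioms.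

v1.1 (REPAIR + DOCFIX after the cross-read of v1 by a reader outside this lineage, recorded in the cell as GAPS C-pv09g9-15;
APPEND-ONLY: every declaration of v1 is unchanged in statement and proof, two theorems are ADDED in §4 and the wording of
the header and of two docstrings is corrected).  FINDING F1 of that cross-read, accepted as stated: v1's `Ginv_posDef`
takes `hKa : (K + ab • (Qbᵀ * Qb)).PosDef` on ALL bond configurations and v1's prose called it *the Thm 3.11-type input*.
It is not: p. 417 [PDF 29] (render re-read as an image for v1.1) prints *"the functional (3.109) is equal to
A → ½⟨A,(Δ + DRD\* + Q\*aQ)A⟩ − ½⟨B,aB⟩ = ½⟨A,Δ_aA⟩ − ½⟨B,aB⟩ (3.111) on the hyperplane (3.110), hence the existence of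
a unique minimum on this hyperplane follows from positive definiteness of the operator Δ_a"* — the print's `Δ_a` CONTAINS
the gauge-fixing term `DRD*`, precisely because the bond form degenerates on the gauge modes `Dλ`, `λ ∈ N(Q′)` (`Q_bDλ = 0`
by (3.115)); whenever `K` kills those modes, `hKa` is unsatisfiable (the reader's Mathlib-only probe: `hKa ∧ K·DN = 0 ∧
(3.115) ⇒ D·N = 0 ⇒ ¬IsUnit (NᵀΔ²N).det` for `τ` nonempty, contradicting `hTs`).  REPAIR (the reader's, verbatim):
`Ginv_posDef_of_Δa` with `hΔa : (K + D·R·Dᵀ + ab • (Qbᵀ * Qb)).PosDef` — the same computation plus `R_Dt_mulVec_tOp`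
(`RD*·TA = 0` makes the `DRD*` part of `Δ_a` invisible on `TA`) — and its minimal form `Ginv_posDef_of_slicePos`
(`K + aQ_bᵀQ_b > 0` on `{RD*A = 0}` suffices).  No theorem of v1 consumed `Ginv_posDef` (`eq_3123` takes positivity on
`N(Q_b)`, `eq_3124`/`eq_3126` invertibility), so nothing else changes; the sibling `B9Eq3152.G1inv_posDef` inherits the
same over-strong hypothesis and is repaired in that file's v1.1. -/

namespace Literature.MathematicalPhysics.QuantumFieldTheory.Balaban1983to89.B9SectDFP

open Matrix MeasureTheory
open scoped Matrix
open Literature.MathematicalPhysics.QuantumFieldTheory.Balaban1983to89.Beta.Composition (kkt blockProp)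
open Literature.MathematicalPhysics.QuantumFieldTheory.Balaban1983to89.Beta.CompositionSingular

/-! ## §1  The constrained Gaussian MEAN is the constrained MINIMISER (the content of "making … a translation to this
minimum", p. 420) -/

section ConstrainedMean

variable {ι κ τ : Type*}

/-- THE `δ(QA − B)`-CONSTRAINED GAUSSIAN MEAN IS THE CONSTRAINED MINIMISER.  For a symmetric form `S` positive definite
on `ker Q = Ran N` (kernel basis `N`: `QN = 0`, `NᵀN`, `QQᵀ` nonsingular, `ι ≃ τ ⊕ κ`) and ANY point `A₀` of the fibre
`{QA = QA₀}` parametrised as `A = A₀ + Nz`:  `∫ e^{−½⟨A,SA⟩}·A dz = (∫ e^{−½⟨A,SA⟩} dz) · ℋ(QA₀)`, `ℋ = minOp S Q`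
([an2's] bordered-inverse minimiser operator; `= S⁻¹Qᵀ(QS⁻¹Qᵀ)⁻¹` when `S` is invertible, `minOp_eq_minMap`).  Proof:
`A₀ − ℋQA₀ ∈ ker Q` is some `Nz₁` (`B9Eq3166.kernel_eq_mulVec`), translation invariance of Lebesgue measure moves the
fibre origin to `ℋQA₀`, the action splits with no cross term ([g13's] `B9SectECov.action_translation`), and the centred
first moment vanishes ([g13's] `B9SectECov.mean_kernelBasis` with source `0`). [folklore] -/
theorem constrainedMean [Fintype ι] [Fintype κ] [Fintype τ] [DecidableEq ι] [DecidableEq κ] [DecidableEq τ]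
    (e : ι ≃ τ ⊕ κ) (S : Matrix ι ι ℝ) (hS : Sᵀ = S) (Q : Matrix κ ι ℝ) (N : Matrix ι τ ℝ)
    (hQN : Q * N = 0) (hNA : IsUnit (Nᵀ * N).det) (hQM : IsUnit (Q * Qᵀ).det) (hT : (Nᵀ * S * N).PosDef)
    (A₀ : ι → ℝ) :
    ∫ z : τ → ℝ, Real.exp (-(1/2 : ℝ) * ((A₀ + N *ᵥ z) ⬝ᵥ S *ᵥ (A₀ + N *ᵥ z))) • (A₀ + N *ᵥ z) =
      (∫ z : τ → ℝ, Real.exp (-(1/2 : ℝ) * ((A₀ + N *ᵥ z) ⬝ᵥ S *ᵥ (A₀ + N *ᵥ z)))) •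
        (minOp S Q *ᵥ (Q *ᵥ A₀)) := by
  have hTu : IsUnit (Nᵀ * S * N).det := (Matrix.isUnit_iff_isUnit_det _).mp hT.isUnit
  have hW : IsUnit (kkt S Q).det := isUnit_kkt_det_of_kernelBasis e S Q N hQN hNA hQM hTu
  set Astar : ι → ℝ := minOp S Q *ᵥ (Q *ᵥ A₀) with hAstar
  -- the fibre origin can be moved to the minimiser
  have hker : Q *ᵥ (A₀ - Astar) = 0 := by
    rw [mulVec_sub, hAstar, mulVec_mulVec, mul_minOp S Q hW, one_mulVec, sub_self]
  set z₁ : τ → ℝ := (Nᵀ * N)⁻¹ *ᵥ (Nᵀ *ᵥ (A₀ - Astar)) with hz₁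
  have hA₀ : A₀ = Astar + N *ᵥ z₁ := by
    rw [hz₁, ← B9Eq3166.kernel_eq_mulVec e Q N hQN hNA hQM hker, add_sub_cancel]
  have hshift : ∀ z : τ → ℝ, A₀ + N *ᵥ z = Astar + N *ᵥ (z + z₁) := fun z => by
    rw [hA₀, mulVec_add, add_assoc, add_comm (N *ᵥ z₁)]
  -- the action splits at the minimiser
  have hsplit : ∀ u : τ → ℝ, (Astar + N *ᵥ u) ⬝ᵥ S *ᵥ (Astar + N *ᵥ u) =
      Astar ⬝ᵥ S *ᵥ Astar + u ⬝ᵥ (Nᵀ * S * N) *ᵥ u := fun u => by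
    rw [hAstar, B9SectECov.action_translation S Q hS hW N hQN (Q *ᵥ A₀) u, B9SectECov.config_quadForm N S u]
  set c : ℝ := Real.exp (-(1/2 : ℝ) * (Astar ⬝ᵥ S *ᵥ Astar)) with hc
  have hexp : ∀ u : τ → ℝ, Real.exp (-(1/2 : ℝ) * ((Astar + N *ᵥ u) ⬝ᵥ S *ᵥ (Astar + N *ᵥ u))) =
      c * Real.exp (-(1/2 : ℝ) * (u ⬝ᵥ (Nᵀ * S * N) *ᵥ u)) := fun u => by
    rw [hsplit, mul_add, Real.exp_add]
  -- translate both integrals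
  have hL : ∫ z : τ → ℝ, Real.exp (-(1/2 : ℝ) * ((A₀ + N *ᵥ z) ⬝ᵥ S *ᵥ (A₀ + N *ᵥ z))) • (A₀ + N *ᵥ z) =
      ∫ u : τ → ℝ, Real.exp (-(1/2 : ℝ) * ((Astar + N *ᵥ u) ⬝ᵥ S *ᵥ (Astar + N *ᵥ u))) • (Astar + N *ᵥ u) := by
    simp_rw [hshift]
    exact integral_add_right_eq_self (μ := (volume : Measure (τ → ℝ)))
      (fun u : τ → ℝ => Real.exp (-(1/2 : ℝ) * ((Astar + N *ᵥ u) ⬝ᵥ S *ᵥ (Astar + N *ᵥ u))) • (Astar + N *ᵥ u)) z₁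
  have hR : ∫ z : τ → ℝ, Real.exp (-(1/2 : ℝ) * ((A₀ + N *ᵥ z) ⬝ᵥ S *ᵥ (A₀ + N *ᵥ z))) =
      ∫ u : τ → ℝ, Real.exp (-(1/2 : ℝ) * ((Astar + N *ᵥ u) ⬝ᵥ S *ᵥ (Astar + N *ᵥ u))) := by
    simp_rw [hshift]
    exact integral_add_right_eq_self (μ := (volume : Measure (τ → ℝ)))
      (fun u : τ → ℝ => Real.exp (-(1/2 : ℝ) * ((Astar + N *ᵥ u) ⬝ᵥ S *ᵥ (Astar + N *ᵥ u)))) z₁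
  rw [hL, hR]
  simp_rw [hexp]
  -- the centred first moment vanishes (g13's mean lemma with source 0)
  have hmean := B9SectECov.mean_kernelBasis e S Q N hQN hNA hQM hT 0
  simp only [dotProduct_zero, add_zero, mulVec_zero, smul_zero] at hmean
  simp_rw [B9SectECov.config_quadForm N S] at hmean
  have hi0 : Integrable (fun u : τ → ℝ => Real.exp (-(1/2 : ℝ) * (u ⬝ᵥ (Nᵀ * S * N) *ᵥ u))) :=
    Beta.GaussianIntegral.integrable_exp_neg_half_quadForm _ hT
  have hi1 : Integrable (fun u : τ → ℝ => Real.exp (-(1/2 : ℝ) * (u ⬝ᵥ (Nᵀ * S * N) *ᵥ u)) • (N *ᵥ u)) := by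
    have h0 := (LinearMap.toContinuousLinearMap (Matrix.mulVecLin N)).integrable_comp
      (B9SectECov.integrable_exp_source_smul (Nᵀ * S * N) hT 0)
    refine h0.congr (Filter.Eventually.of_forall fun u => ?_)
    simp only [LinearMap.coe_toContinuousLinearMap', Matrix.mulVecLin_apply, map_smul, zero_dotProduct, add_zero]
  have hsum : ∀ u : τ → ℝ, (c * Real.exp (-(1/2 : ℝ) * (u ⬝ᵥ (Nᵀ * S * N) *ᵥ u))) • (Astar + N *ᵥ u) =
      c • (Real.exp (-(1/2 : ℝ) * (u ⬝ᵥ (Nᵀ * S * N) *ᵥ u)) • Astar +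
        Real.exp (-(1/2 : ℝ) * (u ⬝ᵥ (Nᵀ * S * N) *ᵥ u)) • (N *ᵥ u)) := fun u => by
    rw [smul_add, mul_smul, mul_smul, ← smul_add]
  simp_rw [hsum]
  rw [integral_smul, integral_add (hi0.smul_const Astar) hi1, hmean, add_zero, integral_smul_const,
    integral_const_mul, smul_smul]

/-- The same for a LINEAR OBSERVABLE `T A` (a matrix `T`): its constrained Gaussian mean is `T ℋ(QA₀)`. [folklore] -/
theorem constrainedMean_map [Fintype ι] [Fintype κ] [Fintype τ] [DecidableEq ι] [DecidableEq κ] [DecidableEq τ]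
    {ρ : Type*} [Fintype ρ] (e : ι ≃ τ ⊕ κ) (S : Matrix ι ι ℝ) (hS : Sᵀ = S) (Q : Matrix κ ι ℝ) (N : Matrix ι τ ℝ)
    (hQN : Q * N = 0) (hNA : IsUnit (Nᵀ * N).det) (hQM : IsUnit (Q * Qᵀ).det) (hT : (Nᵀ * S * N).PosDef)
    (T : Matrix ρ ι ℝ) (A₀ : ι → ℝ) :
    ∫ z : τ → ℝ, Real.exp (-(1/2 : ℝ) * ((A₀ + N *ᵥ z) ⬝ᵥ S *ᵥ (A₀ + N *ᵥ z))) • (T *ᵥ (A₀ + N *ᵥ z)) =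
      (∫ z : τ → ℝ, Real.exp (-(1/2 : ℝ) * ((A₀ + N *ᵥ z) ⬝ᵥ S *ᵥ (A₀ + N *ᵥ z)))) •
        (T *ᵥ (minOp S Q *ᵥ (Q *ᵥ A₀))) := by
  set L : (ι → ℝ) →L[ℝ] (ρ → ℝ) := LinearMap.toContinuousLinearMap (Matrix.mulVecLin T) with hL
  have hLx : ∀ x : ι → ℝ, T *ᵥ x = L x := fun x => rfl
  have hTu : IsUnit (Nᵀ * S * N).det := (Matrix.isUnit_iff_isUnit_det _).mp hT.isUnit
  have hW : IsUnit (kkt S Q).det := isUnit_kkt_det_of_kernelBasis e S Q N hQN hNA hQM hTu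
  -- integrability of the vector-valued integrand, via the split at the minimiser as in `constrainedMean`
  set Astar : ι → ℝ := minOp S Q *ᵥ (Q *ᵥ A₀) with hAstar
  have hker : Q *ᵥ (A₀ - Astar) = 0 := by
    rw [mulVec_sub, hAstar, mulVec_mulVec, mul_minOp S Q hW, one_mulVec, sub_self]
  set z₁ : τ → ℝ := (Nᵀ * N)⁻¹ *ᵥ (Nᵀ *ᵥ (A₀ - Astar)) with hz₁
  have hA₀ : A₀ = Astar + N *ᵥ z₁ := by
    rw [hz₁, ← B9Eq3166.kernel_eq_mulVec e Q N hQN hNA hQM hker, add_sub_cancel]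
  have hshift : ∀ z : τ → ℝ, A₀ + N *ᵥ z = Astar + N *ᵥ (z + z₁) := fun z => by
    rw [hA₀, mulVec_add, add_assoc, add_comm (N *ᵥ z₁)]
  have hsplit : ∀ u : τ → ℝ, (Astar + N *ᵥ u) ⬝ᵥ S *ᵥ (Astar + N *ᵥ u) =
      Astar ⬝ᵥ S *ᵥ Astar + u ⬝ᵥ (Nᵀ * S * N) *ᵥ u := fun u => by
    rw [hAstar, B9SectECov.action_translation S Q hS hW N hQN (Q *ᵥ A₀) u, B9SectECov.config_quadForm N S u]
  set c : ℝ := Real.exp (-(1/2 : ℝ) * (Astar ⬝ᵥ S *ᵥ Astar)) with hc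
  have hi0 : Integrable (fun u : τ → ℝ => Real.exp (-(1/2 : ℝ) * (u ⬝ᵥ (Nᵀ * S * N) *ᵥ u))) :=
    Beta.GaussianIntegral.integrable_exp_neg_half_quadForm _ hT
  have hi1 : Integrable (fun u : τ → ℝ => Real.exp (-(1/2 : ℝ) * (u ⬝ᵥ (Nᵀ * S * N) *ᵥ u)) • (N *ᵥ u)) := by
    have h0 := (LinearMap.toContinuousLinearMap (Matrix.mulVecLin N)).integrable_comp
      (B9SectECov.integrable_exp_source_smul (Nᵀ * S * N) hT 0)
    refine h0.congr (Filter.Eventually.of_forall fun u => ?_)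
    simp only [LinearMap.coe_toContinuousLinearMap', Matrix.mulVecLin_apply, map_smul, zero_dotProduct, add_zero]
  have hint0 : Integrable (fun u : τ → ℝ =>
      Real.exp (-(1/2 : ℝ) * ((Astar + N *ᵥ u) ⬝ᵥ S *ᵥ (Astar + N *ᵥ u))) • (Astar + N *ᵥ u)) := by
    have h := ((hi0.smul_const Astar).smul c).add (hi1.smul c)
    refine h.congr (Filter.Eventually.of_forall fun u => ?_)
    simp only [Pi.add_apply, Pi.smul_apply, hsplit, mul_add, Real.exp_add, smul_add, mul_smul, hc]
  have hint : Integrable (fun z : τ → ℝ =>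
      Real.exp (-(1/2 : ℝ) * ((A₀ + N *ᵥ z) ⬝ᵥ S *ᵥ (A₀ + N *ᵥ z))) • (A₀ + N *ᵥ z)) := by
    simp_rw [hshift]
    exact hint0.comp_add_right z₁
  have hcomp : (fun z : τ → ℝ => Real.exp (-(1/2 : ℝ) * ((A₀ + N *ᵥ z) ⬝ᵥ S *ᵥ (A₀ + N *ᵥ z))) •
      (T *ᵥ (A₀ + N *ᵥ z))) = fun z => L (Real.exp (-(1/2 : ℝ) * ((A₀ + N *ᵥ z) ⬝ᵥ S *ᵥ (A₀ + N *ᵥ z))) •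
        (A₀ + N *ᵥ z)) := by
    funext z; rw [map_smul, ← hLx]
  rw [hcomp, ContinuousLinearMap.integral_comp_comm L hint, constrainedMean e S hS Q N hQN hNA hQM hT A₀, map_smul,
    ← hLx]

end ConstrainedMean

/-! ## §2  The objects of Sect. D over [adv1's] `B9H163` vocabulary: `T = 1 − DG′RD*`, `Δ_π = TᵀKT` ((3.119)),
`G⁻¹ = Δ_π + DRD* + Q*aQ` ((3.122)); gauge invariance on `N(Q′)` -/

section Objects

variable {n m τ b q : Type*}

/-- The LINEAR CONFIGURATION MAP behind (3.119)/(3.121)/(3.123): `T := 1 − DG′RD*` on bond configurations,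
`A ↦ A − DG′RD*A` (`G′ = (Δ + aQ′*Q′)⁻¹` = [adv1's] `B9H163.G'`, `R` = [adv1's] `B9H163.R`, the orthogonal projection
(3.20) onto `R = ΔN(Q′)`; `D` the derivative (3.114), `D*` its transpose). [cite: Balaban1985BackgroundPropagators, (3.119) p.419] -/
noncomputable def tOp [Fintype n] [Fintype m] [DecidableEq n] [DecidableEq m] [DecidableEq b]
    (Δ : Matrix n n ℝ) (Q : Matrix m n ℝ) (a : ℝ) (D : Matrix b n ℝ) : Matrix b b ℝ :=
  1 - D * B9H163.G' Δ Q a * B9H163.R Δ Q a * Dᵀ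

/-- `Δ_π` AS (3.119) DEFINES IT: the matrix `TᵀKT` of the quadratic form `A ↦ ⟨TA, K·TA⟩ = ⟨A − DG′RD*A, Δ(A − DG′RD*A)⟩`,
`K` = the matrix of the bond form written `⟨A, ΔA⟩` in (3.112)/(3.118) (NOT the site Laplacian `Δ = D*D` of `R`, `G′`).
[cite: Balaban1985BackgroundPropagators, (3.119) p.419] -/
noncomputable def piOp [Fintype n] [Fintype m] [Fintype b] [DecidableEq n] [DecidableEq m] [DecidableEq b]
    (K : Matrix b b ℝ) (Δ : Matrix n n ℝ) (Q : Matrix m n ℝ) (a : ℝ) (D : Matrix b n ℝ) : Matrix b b ℝ :=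
  (tOp Δ Q a D)ᵀ * K * tOp Δ Q a D

/-- `G⁻¹ := Δ_π + DRD* + Q*aQ` of (3.122) (`Q` = the bond-variable averaging `Qb : q × b`, `a` = `ab`; `Q*aQ ↦ ab·QbᵀQb`).
[cite: Balaban1985BackgroundPropagators, (3.122) p.420] -/
noncomputable def Ginv [Fintype n] [Fintype m] [Fintype b] [Fintype q] [DecidableEq n] [DecidableEq m] [DecidableEq b]
    (K : Matrix b b ℝ) (Δ : Matrix n n ℝ) (Q : Matrix m n ℝ) (a : ℝ) (D : Matrix b n ℝ) (Qb : Matrix q b ℝ) (ab : ℝ) :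
    Matrix b b ℝ :=
  piOp K Δ Q a D + D * B9H163.R Δ Q a * Dᵀ + ab • (Qbᵀ * Qb)

/-- `TA = A − DG′RD*A`. [cite: Balaban1985BackgroundPropagators, (3.119) p.419] -/
theorem tOp_mulVec [Fintype n] [Fintype m] [Fintype b] [DecidableEq n] [DecidableEq m] [DecidableEq b]
    (Δ : Matrix n n ℝ) (Q : Matrix m n ℝ) (a : ℝ) (D : Matrix b n ℝ) (A : b → ℝ) :
    tOp Δ Q a D *ᵥ A = A - D *ᵥ (B9H163.G' Δ Q a *ᵥ (B9H163.R Δ Q a *ᵥ (Dᵀ *ᵥ A))) := by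
  rw [tOp, sub_mulVec, one_mulVec]
  simp only [← mulVec_mulVec]

/-- `RΔG′R = R`: from `Δ′G′ = 1` (`Δ′ = Δ + aQ′*Q′`), `Q′G′R = 0` ([g13's] `B9SectECov.Q_mul_G'_mul_R`) and `R² = R`
([g13's] `B9SectECov.R_mul_R`). [folklore] -/
theorem R_mul_Δ_mul_G'_mul_R [Fintype n] [Fintype m] [DecidableEq n] [DecidableEq m]
    (Δ : Matrix n n ℝ) (Q : Matrix m n ℝ) (a : ℝ) (hΔ' : IsUnit (B9H163.Δ' Δ Q a))
    (hM' : IsUnit (B9H163.M' Δ Q a)) :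
    B9H163.R Δ Q a * Δ * B9H163.G' Δ Q a * B9H163.R Δ Q a = B9H163.R Δ Q a := by
  have h1 : Δ * B9H163.G' Δ Q a = 1 - a • (Qᵀ * Q * B9H163.G' Δ Q a) := by
    have h := B9H163.Δ'_mul_G' hΔ'
    unfold B9H163.Δ' at h
    rw [Matrix.add_mul, Matrix.smul_mul] at h
    exact eq_sub_of_add_eq h
  rw [Matrix.mul_assoc (B9H163.R Δ Q a) Δ, h1, Matrix.mul_sub, Matrix.mul_one, Matrix.sub_mul,
    B9SectECov.R_mul_R Δ Q a hM', Matrix.mul_smul, Matrix.smul_mul, Matrix.mul_assoc, Matrix.mul_assoc,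
    Matrix.mul_assoc Qᵀ, ← Matrix.mul_assoc Q, B9SectECov.Q_mul_G'_mul_R Δ Q a hM', Matrix.mul_zero, Matrix.mul_zero,
    smul_zero, sub_zero]

/-- adv8's *"RD\*A″ = RD\*A − RD\*DG′RD\*A = 0"* (GAPS C-adv8-1), as the matrix identity `RD*·T = 0` (`D*D = Δ`):
the gauge condition holds identically on the image of `T`. [cite: Balaban1985BackgroundPropagators, (3.119)-(3.121) p.419] -/
theorem R_mul_Dt_mul_tOp [Fintype n] [Fintype m] [Fintype b] [DecidableEq n] [DecidableEq m] [DecidableEq b]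
    (Δ : Matrix n n ℝ) (Q : Matrix m n ℝ) (a : ℝ) (hΔ' : IsUnit (B9H163.Δ' Δ Q a))
    (hM' : IsUnit (B9H163.M' Δ Q a)) (D : Matrix b n ℝ) (hD : Dᵀ * D = Δ) :
    B9H163.R Δ Q a * Dᵀ * tOp Δ Q a D = 0 := by
  rw [tOp, Matrix.mul_sub, Matrix.mul_one, sub_eq_zero]
  calc B9H163.R Δ Q a * Dᵀ = (B9H163.R Δ Q a * Δ * B9H163.G' Δ Q a * B9H163.R Δ Q a) * Dᵀ := by
        rw [R_mul_Δ_mul_G'_mul_R Δ Q a hΔ' hM']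
    _ = B9H163.R Δ Q a * Dᵀ * (D * B9H163.G' Δ Q a * B9H163.R Δ Q a * Dᵀ) := by
        rw [← hD]; simp only [Matrix.mul_assoc]

/-- Pointwise: `RD*(TA) = 0` for every `A`. [cite: Balaban1985BackgroundPropagators, (3.121) p.419] -/
theorem R_Dt_mulVec_tOp [Fintype n] [Fintype m] [Fintype b] [DecidableEq n] [DecidableEq m] [DecidableEq b]
    (Δ : Matrix n n ℝ) (Q : Matrix m n ℝ) (a : ℝ) (hΔ' : IsUnit (B9H163.Δ' Δ Q a))
    (hM' : IsUnit (B9H163.M' Δ Q a)) (D : Matrix b n ℝ) (hD : Dᵀ * D = Δ) (A : b → ℝ) :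
    B9H163.R Δ Q a *ᵥ (Dᵀ *ᵥ (tOp Δ Q a D *ᵥ A)) = 0 := by
  rw [mulVec_mulVec, mulVec_mulVec, R_mul_Dt_mul_tOp Δ Q a hΔ' hM' D hD, zero_mulVec]

/-- adv8's *"QA″ = QA"* (GAPS C-adv8-1): `Q_b(TA) = Q_bA`, by (3.115) `Q_bD = D̄Q′` and `Q′G′R = 0`.
[cite: Balaban1985BackgroundPropagators, (3.115) p.418, (3.121) p.419] -/
theorem Qb_mulVec_tOp [Fintype n] [Fintype m] [Fintype b] [Fintype q] [DecidableEq n] [DecidableEq m] [DecidableEq b]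
    (Δ : Matrix n n ℝ) (Q : Matrix m n ℝ) (a : ℝ) (hM' : IsUnit (B9H163.M' Δ Q a)) (D : Matrix b n ℝ)
    (Qb : Matrix q b ℝ) (Dbar : Matrix q m ℝ) (h115 : Qb * D = Dbar * Q) (A : b → ℝ) :
    Qb *ᵥ (tOp Δ Q a D *ᵥ A) = Qb *ᵥ A := by
  have h0 : Qb * (D * B9H163.G' Δ Q a * B9H163.R Δ Q a * Dᵀ) = 0 := by
    rw [Matrix.mul_assoc D, Matrix.mul_assoc D, ← Matrix.mul_assoc Qb, h115, Matrix.mul_assoc Dbar,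
      ← Matrix.mul_assoc Q, ← Matrix.mul_assoc Q, B9SectECov.Q_mul_G'_mul_R Δ Q a hM', Matrix.zero_mul, Matrix.mul_zero]
  rw [tOp, sub_mulVec, one_mulVec, mulVec_sub, mulVec_mulVec, h0, zero_mulVec, sub_zero]

/-- `T` KILLS THE GAUGE MODES `Dλ`, `λ ∈ N(Q′)`: `T·(DN) = 0` (`D*D = Δ`, `RΔ = Δ` and `G′Δ = 1` on `N(Q′)` — [g13's]
`B9SectECov.R_mul_Δ_mul_kernel`, `G'_mul_Δ_mul_kernel`). [cite: Balaban1985BackgroundPropagators, (3.119) p.419] -/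
theorem tOp_mul_gauge [Fintype n] [Fintype m] [Fintype τ] [Fintype b] [DecidableEq n] [DecidableEq m] [DecidableEq b]
    (Δ : Matrix n n ℝ) (Q : Matrix m n ℝ) (a : ℝ) (hΔ' : IsUnit (B9H163.Δ' Δ Q a)) (N : Matrix n τ ℝ)
    (hQN : Q * N = 0) (D : Matrix b n ℝ) (hD : Dᵀ * D = Δ) : tOp Δ Q a D * (D * N) = 0 := by
  rw [tOp, Matrix.sub_mul, Matrix.one_mul, sub_eq_zero]
  symm
  calc D * B9H163.G' Δ Q a * B9H163.R Δ Q a * Dᵀ * (D * N)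
      = D * (B9H163.G' Δ Q a * (B9H163.R Δ Q a * (Dᵀ * D * N))) := by simp only [Matrix.mul_assoc]
    _ = D * N := by
        rw [hD, B9SectECov.R_mul_Δ_mul_kernel Δ Q a hΔ' N hQN, B9SectECov.G'_mul_Δ_mul_kernel Δ Q a hΔ' N hQN]

/-- Pointwise: `T(A + Dλ) = TA` for `λ = Nz ∈ N(Q′)`. [cite: Balaban1985BackgroundPropagators, (3.119) p.419] -/
theorem tOp_mulVec_gauge [Fintype n] [Fintype m] [Fintype τ] [Fintype b] [DecidableEq n] [DecidableEq m] [DecidableEq b]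
    (Δ : Matrix n n ℝ) (Q : Matrix m n ℝ) (a : ℝ) (hΔ' : IsUnit (B9H163.Δ' Δ Q a)) (N : Matrix n τ ℝ)
    (hQN : Q * N = 0) (D : Matrix b n ℝ) (hD : Dᵀ * D = Δ) (A : b → ℝ) (z : τ → ℝ) :
    tOp Δ Q a D *ᵥ (A + D *ᵥ (N *ᵥ z)) = tOp Δ Q a D *ᵥ A := by
  have h := tOp_mul_gauge Δ Q a hΔ' N hQN D hD
  rw [← Matrix.mul_assoc] at h
  rw [mulVec_add, mulVec_mulVec, mulVec_mulVec, h, zero_mulVec, add_zero]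

/-- **(3.119)**: `⟨A, Δ_πA⟩ = ⟨TA, K·TA⟩ = ⟨A − DG′RD*A, Δ(A − DG′RD*A)⟩`. [cite: Balaban1985BackgroundPropagators, (3.119) p.419] -/
theorem piOp_quadForm [Fintype n] [Fintype m] [Fintype b] [DecidableEq n] [DecidableEq m] [DecidableEq b]
    (K : Matrix b b ℝ) (Δ : Matrix n n ℝ) (Q : Matrix m n ℝ) (a : ℝ) (D : Matrix b n ℝ) (A : b → ℝ) :
    A ⬝ᵥ piOp K Δ Q a D *ᵥ A = (tOp Δ Q a D *ᵥ A) ⬝ᵥ K *ᵥ (tOp Δ Q a D *ᵥ A) := by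
  unfold piOp
  exact (B9SectECov.config_quadForm (tOp Δ Q a D) K A).symm

/-- *"The quadratic form is invariant with respect to gauge transformations determined by λ ∈ N(Q′)"* (p. 419, after
(3.119)): `⟨A + Dλ, Δ_π(A + Dλ)⟩ = ⟨A, Δ_πA⟩` for `λ = Nz`, `Q′N = 0`. [cite: Balaban1985BackgroundPropagators, (3.119) p.419] -/
theorem piOp_gauge [Fintype n] [Fintype m] [Fintype τ] [Fintype b] [DecidableEq n] [DecidableEq m] [DecidableEq b]
    (K : Matrix b b ℝ) (Δ : Matrix n n ℝ) (Q : Matrix m n ℝ) (a : ℝ) (hΔ' : IsUnit (B9H163.Δ' Δ Q a))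
    (N : Matrix n τ ℝ) (hQN : Q * N = 0) (D : Matrix b n ℝ) (hD : Dᵀ * D = Δ) (A : b → ℝ) (z : τ → ℝ) :
    (A + D *ᵥ (N *ᵥ z)) ⬝ᵥ piOp K Δ Q a D *ᵥ (A + D *ᵥ (N *ᵥ z)) = A ⬝ᵥ piOp K Δ Q a D *ᵥ A := by
  rw [piOp_quadForm, piOp_quadForm, tOp_mulVec_gauge Δ Q a hΔ' N hQN D hD]

/-- `Δ_π` also kills the gauge modes as an operator: `Δ_π·(DN) = 0` and `Δ_πᵀ·(DN) = 0` (no symmetry of `K` needed).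
[cite: Balaban1985BackgroundPropagators, (3.119) p.419] -/
theorem piOp_mul_gauge [Fintype n] [Fintype m] [Fintype τ] [Fintype b] [DecidableEq n] [DecidableEq m] [DecidableEq b]
    (K : Matrix b b ℝ) (Δ : Matrix n n ℝ) (Q : Matrix m n ℝ) (a : ℝ) (hΔ' : IsUnit (B9H163.Δ' Δ Q a))
    (N : Matrix n τ ℝ) (hQN : Q * N = 0) (D : Matrix b n ℝ) (hD : Dᵀ * D = Δ) :
    piOp K Δ Q a D * (D * N) = 0 ∧ (piOp K Δ Q a D)ᵀ * (D * N) = 0 := by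
  have h := tOp_mul_gauge Δ Q a hΔ' N hQN D hD
  refine ⟨?_, ?_⟩
  · rw [piOp, Matrix.mul_assoc, h, Matrix.mul_zero]
  · rw [piOp, transpose_mul, transpose_mul, transpose_transpose, Matrix.mul_assoc, Matrix.mul_assoc, h,
      Matrix.mul_zero, Matrix.mul_zero]

end Objects

/-! ## §3  (3.118) ⇒ (3.119) and the three equalities of (3.121), at the (tested) measure level of [this lineage's]
`B9Eq3166` (`subInt` = Lebesgue integral over the subspace `N(Q′) = Ran N`, `δ_R` tested against `ψ(w)`, `w ∈ R = ΔN(Q′)`) -/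

section FP

variable {n m τ b q : Type*}

/-- *"where we have used the identity RD\*(A − Dλ) = RD\*A − RΔλ = RD\*A − Δλ, which holds by the definition of R and the
fact that λ ∈ N(Q′)"* (p. 419, after (3.118)), `λ = Nz`. [cite: Balaban1985BackgroundPropagators, (3.118) p.419] -/
theorem eq_3118_identity [Fintype n] [Fintype m] [Fintype τ] [Fintype b] [DecidableEq n] [DecidableEq m]
    (Δ : Matrix n n ℝ) (Q : Matrix m n ℝ) (a : ℝ) (hΔ' : IsUnit (B9H163.Δ' Δ Q a)) (N : Matrix n τ ℝ)
    (hQN : Q * N = 0) (D : Matrix b n ℝ) (hD : Dᵀ * D = Δ) (A : b → ℝ) (z : τ → ℝ) :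
    B9H163.R Δ Q a *ᵥ (Dᵀ *ᵥ (A - D *ᵥ (N *ᵥ z))) = B9H163.R Δ Q a *ᵥ (Dᵀ *ᵥ A) - Δ *ᵥ (N *ᵥ z) := by
  rw [sub_eq_add_neg, ← mulVec_neg, ← mulVec_neg, B9Eq3166.eq_3161_R (B9H163.R Δ Q a) D A (N *ᵥ (-z)), hD,
    B9Eq3166.R_mulVec_Δ_kernel Δ Q a hΔ' N hQN, mulVec_neg, mulVec_neg, ← sub_eq_add_neg]

/-- **(3.118) AT MEASURE LEVEL** (`δ_R` tested against `ψ` over `R = ΔN(Q′)`, `w`-integration first): for every `F(λ)`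
(in (3.118): `F(λ) = e^{−½⟨A − Dλ, Δ(A − Dλ)⟩}`, `A` fixed),
`∫_R ψ(w)·F(G′Rw) dw = |det(Δ↾_{N(Q′)})| · ∫_{N(Q′)} ψ(Δλ)F(λ) dλ` — the right member is `∫_R dw ψ(w)` applied to the
printed right side `|det(Δ↾_{N(Q′)})| ∫dλ δ(Q′λ)δ_R(w − Δλ)F(λ)`, the left member says that this distribution in `w` IS the
function `w ↦ F(G′Rw)`: the δ's cut out `λ = G′Rw` with unit total weight ([this lineage's] `B9Eq3166.eq_3160`, (3.160) =
the same identity).  At `w = RD*A` this is *"Calculating the integral above we get"* (3.119): `e^{−½⟨A,Δ_πA⟩} = F(G′RD*A)`.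
[cite: Balaban1985BackgroundPropagators, (3.118)-(3.119) p.419] -/
theorem eq_3118 [Fintype n] [Fintype m] [Fintype τ] [DecidableEq n] [DecidableEq m] [DecidableEq τ]
    (Δ : Matrix n n ℝ) (Q : Matrix m n ℝ) (a : ℝ) (hΔ' : IsUnit (B9H163.Δ' Δ Q a)) (N : Matrix n τ ℝ)
    (hQN : Q * N = 0) (hNA : IsUnit (Nᵀ * N).det) (ψ F : (n → ℝ) → ℝ) :
    B9Eq3166.subInt (Δ * N) (fun w => ψ w * F (B9H163.G' Δ Q a *ᵥ (B9H163.R Δ Q a *ᵥ w))) =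
      B9Eq3166.absDetOn Δ N * B9Eq3166.subInt N (fun l => ψ (Δ *ᵥ l) * F l) := by
  rw [B9Eq3166.eq_3160 Δ N hNA]
  unfold B9Eq3166.subInt
  simp only [B9Eq3166.G'R_mulVec_Δ_kernel Δ Q a hΔ' N hQN]

/-- **(3.118) ⇒ (3.119), the evaluation** (with [this lineage's] `B9Eq3166.eq_3160_point`: the two δ's of (3.118) cut out
the single point `λ = G′RD*A` of `N(Q′)`): the exponent's configuration there is `A − Dλ = A − DG′RD*A = TA`, so
`⟨A − Dλ, K(A − Dλ)⟩ = ⟨A, Δ_πA⟩`. [cite: Balaban1985BackgroundPropagators, (3.119) p.419] -/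
theorem eq_3119 [Fintype n] [Fintype m] [Fintype b] [DecidableEq n] [DecidableEq m] [DecidableEq b]
    (K : Matrix b b ℝ) (Δ : Matrix n n ℝ) (Q : Matrix m n ℝ) (a : ℝ) (D : Matrix b n ℝ) (A : b → ℝ) :
    (A - D *ᵥ ((B9H163.G' Δ Q a * B9H163.R Δ Q a) *ᵥ (Dᵀ *ᵥ A))) ⬝ᵥ
        K *ᵥ (A - D *ᵥ ((B9H163.G' Δ Q a * B9H163.R Δ Q a) *ᵥ (Dᵀ *ᵥ A))) =
      A ⬝ᵥ piOp K Δ Q a D *ᵥ A := by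
  rw [← mulVec_mulVec, ← tOp_mulVec, piOp_quadForm]

/-- **(3.121), second equality — the constraint**: under `A → A + Dλ`, `λ = Nz ∈ N(Q′)`, `δ(Q_bA − B)` is unchanged:
`Q_b(A + Dλ) = Q_bA` (*"we have used (3.115) and the condition Q′λ = 0"*, p. 420).
[cite: Balaban1985BackgroundPropagators, (3.121) p.419, p.420] -/
theorem eq_3121_Q [Fintype n] [Fintype m] [Fintype τ] [Fintype b]
    (Q : Matrix m n ℝ) (N : Matrix n τ ℝ) (hQN : Q * N = 0) (D : Matrix b n ℝ) (Qb : Matrix q b ℝ)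
    (Dbar : Matrix q m ℝ) (h115 : Qb * D = Dbar * Q) (A : b → ℝ) (z : τ → ℝ) :
    Qb *ᵥ (A + D *ᵥ (N *ᵥ z)) = Qb *ᵥ A := by
  rw [mulVec_add, mulVec_mulVec, h115, mulVec_mulVec, Matrix.mul_assoc, hQN, Matrix.mul_zero, zero_mulVec, add_zero]

/-- **(3.121), second equality — the gauge-fixing factors**: under `A → A + Dλ`, `λ = Nz ∈ N(Q′)`,
`RD*(A + Dλ) = RD*A + Δλ`; hence `δ_R(RD*A) ↦ δ_R(RD*A + Δλ)` and `‖RD*A − Δλ‖² ↦ ‖RD*A‖²` (the weight leaves the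
λ-integral and joins the exponent as `−½‖RD*A‖²`). [cite: Balaban1985BackgroundPropagators, (3.121) p.419] -/
theorem eq_3121_R [Fintype n] [Fintype m] [Fintype τ] [Fintype b] [DecidableEq n] [DecidableEq m]
    (Δ : Matrix n n ℝ) (Q : Matrix m n ℝ) (a : ℝ) (hΔ' : IsUnit (B9H163.Δ' Δ Q a)) (N : Matrix n τ ℝ)
    (hQN : Q * N = 0) (D : Matrix b n ℝ) (hD : Dᵀ * D = Δ) (A : b → ℝ) (z : τ → ℝ) :
    B9H163.R Δ Q a *ᵥ (Dᵀ *ᵥ (A + D *ᵥ (N *ᵥ z))) = B9H163.R Δ Q a *ᵥ (Dᵀ *ᵥ A) + Δ *ᵥ (N *ᵥ z) ∧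
    B9H163.R Δ Q a *ᵥ (Dᵀ *ᵥ (A + D *ᵥ (N *ᵥ z))) - Δ *ᵥ (N *ᵥ z) = B9H163.R Δ Q a *ᵥ (Dᵀ *ᵥ A) := by
  have h : B9H163.R Δ Q a *ᵥ (Dᵀ *ᵥ (A + D *ᵥ (N *ᵥ z))) = B9H163.R Δ Q a *ᵥ (Dᵀ *ᵥ A) + Δ *ᵥ (N *ᵥ z) := by
    rw [B9Eq3166.eq_3161_R (B9H163.R Δ Q a) D A (N *ᵥ z), hD, B9Eq3166.R_mulVec_Δ_kernel Δ Q a hΔ' N hQN]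
  exact ⟨h, by rw [h, add_sub_cancel_right]⟩

/-- **(3.121), second equality — the exponent**: `⟨A + Dλ, Δ_π(A + Dλ)⟩ = ⟨A, Δ_πA⟩` (`piOp_gauge`) and the field factor
`A ↦ A + Dλ`; together with `eq_3121_Q`, `eq_3121_R` every factor of the middle member of (3.121) is accounted for.
[cite: Balaban1985BackgroundPropagators, (3.121) p.419] -/
theorem eq_3121_exponent [Fintype n] [Fintype m] [Fintype τ] [Fintype b] [DecidableEq n] [DecidableEq m] [DecidableEq b]
    (K : Matrix b b ℝ) (Δ : Matrix n n ℝ) (Q : Matrix m n ℝ) (a : ℝ) (hΔ' : IsUnit (B9H163.Δ' Δ Q a))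
    (N : Matrix n τ ℝ) (hQN : Q * N = 0) (D : Matrix b n ℝ) (hD : Dᵀ * D = Δ) (A : b → ℝ) (z : τ → ℝ) :
    Real.exp (-(1/2 : ℝ) * ((A + D *ᵥ (N *ᵥ z)) ⬝ᵥ piOp K Δ Q a D *ᵥ (A + D *ᵥ (N *ᵥ z)))) =
      Real.exp (-(1/2 : ℝ) * (A ⬝ᵥ piOp K Δ Q a D *ᵥ A)) := by
  rw [piOp_gauge K Δ Q a hΔ' N hQN D hD]

/-- **(3.121), third equality — the λ-integration AT MEASURE LEVEL** ([this lineage's] `B9Eq3166.eq_3166_F` = (3.166),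
the same computation): for every component `i` and every test function `ψ` of `w = RD*A ∈ R`,
`∫_{N(Q′)} ψ(−Δλ)·(A + Dλ)ᵢ dλ = |det(Δ↾_{N(Q′)})|⁻¹ ∫_R ψ(w)·(A − DG′Rw)ᵢ dw`, i.e.
`∫dλ δ(Q′λ)δ_R(w + Δλ)(A + Dλ) = |det(Δ↾_{N(Q′)})|⁻¹(A − DG′Rw)` as distributions in `w ∈ R`; at `w = RD*A` the field is
`A − DG′RD*A` (`eq_3121_field`). [cite: Balaban1985BackgroundPropagators, (3.121) p.419] -/
theorem eq_3121_lambda [Fintype n] [Fintype m] [Fintype τ] [Fintype b] [DecidableEq n] [DecidableEq m] [DecidableEq τ]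
    (Δ : Matrix n n ℝ) (Q : Matrix m n ℝ) (a : ℝ) (hΔ : Δ.IsSymm) (hΔ' : IsUnit (B9H163.Δ' Δ Q a))
    (N : Matrix n τ ℝ) (hQN : Q * N = 0) (hNA : IsUnit (Nᵀ * N).det) (hT : IsUnit (Nᵀ * (Δ * Δ) * N).det)
    (D : Matrix b n ℝ) (ψ : (n → ℝ) → ℝ) (A : b → ℝ) (i : b) :
    B9Eq3166.subInt N (fun l => ψ (-(Δ *ᵥ l)) * (A + D *ᵥ l) i) =
      (B9Eq3166.absDetOn Δ N)⁻¹ *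
        B9Eq3166.subInt (Δ * N) (fun w => ψ w * (A - D *ᵥ (B9H163.G' Δ Q a *ᵥ (B9H163.R Δ Q a *ᵥ w))) i) := by
  have h := B9Eq3166.eq_3166_F Δ Q a hΔ hΔ' N hQN hNA hT ψ (fun l => (A + D *ᵥ l) i)
  simp only [mulVec_neg, ← sub_eq_add_neg] at h
  exact h

/-- The field of the last member of (3.121) at `w = RD*A`: `A − DG′R(RD*A) = A − DG′RD*A = TA` (`R² = R`, [g13's]
`B9SectECov.R_mul_R`). [cite: Balaban1985BackgroundPropagators, (3.121) p.419] -/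
theorem eq_3121_field [Fintype n] [Fintype m] [Fintype b] [DecidableEq n] [DecidableEq m] [DecidableEq b]
    (Δ : Matrix n n ℝ) (Q : Matrix m n ℝ) (a : ℝ) (hM' : IsUnit (B9H163.M' Δ Q a)) (D : Matrix b n ℝ) (A : b → ℝ) :
    A - D *ᵥ (B9H163.G' Δ Q a *ᵥ (B9H163.R Δ Q a *ᵥ (B9H163.R Δ Q a *ᵥ (Dᵀ *ᵥ A)))) = tOp Δ Q a D *ᵥ A := by
  rw [tOp_mulVec, mulVec_mulVec (Dᵀ *ᵥ A) (B9H163.R Δ Q a) (B9H163.R Δ Q a), B9SectECov.R_mul_R Δ Q a hM']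

end FP

/-! ## §4  (3.122): `G⁻¹`, the value of the action on the fibre `Q_bA = B`, and its positivity (adv8's sharpening made kernel) -/

section GinvForm

variable {n m τ b q : Type*}

/-- **(3.122)**: on the fibre `Q_bA = B`, `⟨A, (Δ_π + DRD*)A⟩ = ⟨A, G⁻¹A⟩ − a⟨B, B⟩` (`G⁻¹ = Δ_π + DRD* + Q*aQ`).
[cite: Balaban1985BackgroundPropagators, (3.122) p.420] -/
theorem eq_3122 [Fintype n] [Fintype m] [Fintype b] [Fintype q] [DecidableEq n] [DecidableEq m] [DecidableEq b]
    (K : Matrix b b ℝ) (Δ : Matrix n n ℝ) (Q : Matrix m n ℝ) (a : ℝ) (D : Matrix b n ℝ) (Qb : Matrix q b ℝ) (ab : ℝ)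
    (A : b → ℝ) (B : q → ℝ) (hB : Qb *ᵥ A = B) :
    A ⬝ᵥ (piOp K Δ Q a D + D * B9H163.R Δ Q a * Dᵀ) *ᵥ A =
      A ⬝ᵥ Ginv K Δ Q a D Qb ab *ᵥ A - ab * (B ⬝ᵥ B) := by
  rw [Ginv, add_mulVec _ (ab • (Qbᵀ * Qb)), dotProduct_add, Matrix.smul_mulVec, dotProduct_smul,
    Beta.GaussianIntegral.dotProduct_transpose_mul_self_mulVec, hB, smul_eq_mul, add_sub_cancel_right]

/-- adv8's SHARPENING (GAPS C-adv8-1) made kernel: `⟨A, G⁻¹A⟩ = ⟨A″,(K + aQ_bᵀQ_b)A″⟩ + ‖RD*A‖²` EXACTLY, `A″ = TA` —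
because `Q_bA″ = Q_bA` (`Qb_mulVec_tOp`) and `DRD* = (RD*)ᵀ(RD*)` (`R` a symmetric idempotent); the first term EQUALS
adv8's `⟨A″, Δ_aA″⟩` with the PRINT's `Δ_a = K + DRD* + Q*aQ` ((3.111) p. 417) since `RD*A″ = 0` (`R_Dt_mulVec_tOp`) —
v1.1 wording (v1 wrote *"Δ_a = K + Q\*aQ"*, which is not the print's `Δ_a`).
[cite: Balaban1985BackgroundPropagators, (3.122) p.420] -/
theorem Ginv_quadForm [Fintype n] [Fintype m] [Fintype b] [Fintype q] [DecidableEq n] [DecidableEq m] [DecidableEq b]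
    (K : Matrix b b ℝ) (Δ : Matrix n n ℝ) (Q : Matrix m n ℝ) (a : ℝ) (hΔ : Δ.IsSymm)
    (hM' : IsUnit (B9H163.M' Δ Q a)) (D : Matrix b n ℝ) (Qb : Matrix q b ℝ) (Dbar : Matrix q m ℝ)
    (h115 : Qb * D = Dbar * Q) (ab : ℝ) (A : b → ℝ) :
    A ⬝ᵥ Ginv K Δ Q a D Qb ab *ᵥ A =
      (tOp Δ Q a D *ᵥ A) ⬝ᵥ (K + ab • (Qbᵀ * Qb)) *ᵥ (tOp Δ Q a D *ᵥ A) +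
        (B9H163.R Δ Q a *ᵥ (Dᵀ *ᵥ A)) ⬝ᵥ (B9H163.R Δ Q a *ᵥ (Dᵀ *ᵥ A)) := by
  have hRt := B9SectECov.R_transpose Δ Q a hΔ
  have hRR := B9SectECov.R_mul_R Δ Q a hM'
  have hRD : D * B9H163.R Δ Q a * Dᵀ = (B9H163.R Δ Q a * Dᵀ)ᵀ * (B9H163.R Δ Q a * Dᵀ) := by
    rw [transpose_mul, transpose_transpose, hRt]
    simp only [Matrix.mul_assoc]
    rw [← Matrix.mul_assoc (B9H163.R Δ Q a) (B9H163.R Δ Q a), hRR]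
  have hsq : A ⬝ᵥ (ab • (Qbᵀ * Qb)) *ᵥ A = ab * ((Qb *ᵥ A) ⬝ᵥ (Qb *ᵥ A)) := by
    rw [Matrix.smul_mulVec, dotProduct_smul, Beta.GaussianIntegral.dotProduct_transpose_mul_self_mulVec, smul_eq_mul]
  have hsq' : (tOp Δ Q a D *ᵥ A) ⬝ᵥ (ab • (Qbᵀ * Qb)) *ᵥ (tOp Δ Q a D *ᵥ A) = ab * ((Qb *ᵥ A) ⬝ᵥ (Qb *ᵥ A)) := by
    rw [Matrix.smul_mulVec, dotProduct_smul, Beta.GaussianIntegral.dotProduct_transpose_mul_self_mulVec,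
      Qb_mulVec_tOp Δ Q a hM' D Qb Dbar h115, smul_eq_mul]
  rw [Ginv, add_mulVec, add_mulVec, dotProduct_add, dotProduct_add, piOp_quadForm, hRD,
    Beta.GaussianIntegral.dotProduct_transpose_mul_self_mulVec, ← mulVec_mulVec, hsq, add_mulVec, dotProduct_add, hsq']
  ring

/-- `G⁻¹` is symmetric (for symmetric `K`, `Δ`). [cite: Balaban1985BackgroundPropagators, (3.122) p.420] -/
theorem Ginv_transpose [Fintype n] [Fintype m] [Fintype b] [Fintype q] [DecidableEq n] [DecidableEq m] [DecidableEq b]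
    (K : Matrix b b ℝ) (hK : Kᵀ = K) (Δ : Matrix n n ℝ) (Q : Matrix m n ℝ) (a : ℝ) (hΔ : Δ.IsSymm) (D : Matrix b n ℝ)
    (Qb : Matrix q b ℝ) (ab : ℝ) : (Ginv K Δ Q a D Qb ab)ᵀ = Ginv K Δ Q a D Qb ab := by
  have hRt := B9SectECov.R_transpose Δ Q a hΔ
  rw [Ginv, piOp, transpose_add, transpose_add, transpose_mul, transpose_mul, transpose_transpose, hK, transpose_mul,
    transpose_mul, transpose_transpose, hRt, transpose_smul, transpose_mul, transpose_transpose, ← Matrix.mul_assoc,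
    ← Matrix.mul_assoc]

/-- v1 (KEPT; superseded by `Ginv_posDef_of_Δa` / `Ginv_posDef_of_slicePos` below — v1.1): `G⁻¹ > 0` IF `K + aQ_bᵀQ_b`
is positive definite on ALL bond configurations.  Kernel-true, but the hypothesis `hKa` is STRONGER than the print's
positivity input `Δ_a = K + DRD* + Q*aQ > 0` ((3.111) p. 417, Theorem 3.11) and is unsatisfiable whenever `K` kills the
gauge modes `Dλ`, `λ ∈ N(Q′)` (cross-read finding F1, GAPS C-pv09g9-15; v1's docstring wrongly called `K + Q*aQ` *"the
paper's positivity input (3.112), Theorem 3.11"*).  Do not instantiate at Bałaban's operators; use the v1.1 theorems.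
[cite: Balaban1985BackgroundPropagators, (3.122) p.420] -/
theorem Ginv_posDef [Fintype n] [Fintype m] [Fintype b] [Fintype q] [DecidableEq n] [DecidableEq m] [DecidableEq b]
    (K : Matrix b b ℝ) (hK : Kᵀ = K) (Δ : Matrix n n ℝ) (Q : Matrix m n ℝ) (a : ℝ) (hΔ : Δ.IsSymm)
    (hM' : IsUnit (B9H163.M' Δ Q a)) (D : Matrix b n ℝ) (Qb : Matrix q b ℝ) (Dbar : Matrix q m ℝ)
    (h115 : Qb * D = Dbar * Q) (ab : ℝ) (hKa : (K + ab • (Qbᵀ * Qb)).PosDef) :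
    (Ginv K Δ Q a D Qb ab).PosDef := by
  refine Matrix.PosDef.of_dotProduct_mulVec_pos ?_ fun x hx => ?_
  · exact Matrix.isHermitian_iff_isSymm.mpr (Ginv_transpose K hK Δ Q a hΔ D Qb ab)
  · rw [star_trivial, Ginv_quadForm K Δ Q a hΔ hM' D Qb Dbar h115 ab x]
    have h2 : 0 ≤ (B9H163.R Δ Q a *ᵥ (Dᵀ *ᵥ x)) ⬝ᵥ (B9H163.R Δ Q a *ᵥ (Dᵀ *ᵥ x)) :=
      Finset.sum_nonneg fun j _ => mul_self_nonneg _
    by_cases hT : tOp Δ Q a D *ᵥ x = 0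
    · have hR : B9H163.R Δ Q a *ᵥ (Dᵀ *ᵥ x) ≠ 0 := by
        intro hR
        apply hx
        have hx' := tOp_mulVec Δ Q a D x
        rw [hT, hR, mulVec_zero, mulVec_zero, sub_zero] at hx'
        exact hx'.symm
      have h2' : 0 < (B9H163.R Δ Q a *ᵥ (Dᵀ *ᵥ x)) ⬝ᵥ (B9H163.R Δ Q a *ᵥ (Dᵀ *ᵥ x)) :=
        lt_of_le_of_ne h2 (fun h => hR (dotProduct_self_eq_zero.mp h.symm))
      rw [hT, zero_dotProduct, zero_add]
      exact h2'
    · have h1 := hKa.dotProduct_mulVec_pos hT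
      rw [star_trivial] at h1
      exact add_pos_of_pos_of_nonneg h1 h2

/-- **v1.1 — POSITIVITY OF `G⁻¹` FROM THE MINIMAL INPUT**: if `K + aQ_bᵀQ_b` is positive on the gauge-fixed hyperplane
`{A : RD*A = 0}` (the domain of integration of (3.112), p. 417: *"The integrals in (3.112) are convergent because on the
domains of integration we can replace the form 1/2⟨A,ΔA⟩ by the right-hand side of (3.111), and we can use again the
positive definiteness of Δ_a"*), then `G⁻¹ = Δ_π + DRD* + Q*aQ` is positive definite — EXACTLY, with no perturbation
argument ([adv8's] sharpening, GAPS C-adv8-1): `⟨A, G⁻¹A⟩ = ⟨TA,(K + aQ_bᵀQ_b)TA⟩ + ‖RD*A‖²` (`Ginv_quadForm`), `RD*·TA = 0`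
(`R_Dt_mulVec_tOp`), and `A = TA + DG′(RD*A)` (`tOp_mulVec`).
[cite: Balaban1985BackgroundPropagators, (3.111)–(3.112) p.417, (3.122) p.420] -/
theorem Ginv_posDef_of_slicePos [Fintype n] [Fintype m] [Fintype b] [Fintype q] [DecidableEq n] [DecidableEq m]
    [DecidableEq b] (K : Matrix b b ℝ) (hK : Kᵀ = K) (Δ : Matrix n n ℝ) (Q : Matrix m n ℝ) (a : ℝ) (hΔ : Δ.IsSymm)
    (hΔ' : IsUnit (B9H163.Δ' Δ Q a)) (hM' : IsUnit (B9H163.M' Δ Q a)) (D : Matrix b n ℝ) (hD : Dᵀ * D = Δ)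
    (Qb : Matrix q b ℝ) (Dbar : Matrix q m ℝ) (h115 : Qb * D = Dbar * Q) (ab : ℝ)
    (hslice : ∀ A : b → ℝ, B9H163.R Δ Q a *ᵥ (Dᵀ *ᵥ A) = 0 → A ≠ 0 → 0 < A ⬝ᵥ (K + ab • (Qbᵀ * Qb)) *ᵥ A) :
    (Ginv K Δ Q a D Qb ab).PosDef := by
  refine Matrix.PosDef.of_dotProduct_mulVec_pos ?_ fun x hx => ?_
  · exact Matrix.isHermitian_iff_isSymm.mpr (Ginv_transpose K hK Δ Q a hΔ D Qb ab)
  · rw [star_trivial, Ginv_quadForm K Δ Q a hΔ hM' D Qb Dbar h115 ab x]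
    have h2 : 0 ≤ (B9H163.R Δ Q a *ᵥ (Dᵀ *ᵥ x)) ⬝ᵥ (B9H163.R Δ Q a *ᵥ (Dᵀ *ᵥ x)) :=
      Finset.sum_nonneg fun j _ => mul_self_nonneg _
    by_cases hT : tOp Δ Q a D *ᵥ x = 0
    · have hR : B9H163.R Δ Q a *ᵥ (Dᵀ *ᵥ x) ≠ 0 := by
        intro hR
        apply hx
        have hx' := tOp_mulVec Δ Q a D x
        rw [hT, hR, mulVec_zero, mulVec_zero, sub_zero] at hx'
        exact hx'.symm
      have h2' : 0 < (B9H163.R Δ Q a *ᵥ (Dᵀ *ᵥ x)) ⬝ᵥ (B9H163.R Δ Q a *ᵥ (Dᵀ *ᵥ x)) :=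
        lt_of_le_of_ne h2 (fun h => hR (dotProduct_self_eq_zero.mp h.symm))
      rw [hT, zero_dotProduct, zero_add]
      exact h2'
    · exact add_pos_of_pos_of_nonneg (hslice _ (R_Dt_mulVec_tOp Δ Q a hΔ' hM' D hD x) hT) h2

/-- **v1.1 — POSITIVITY OF `G⁻¹` FROM THE PRINT'S `Δ_a`** (the repair named by the cross-read of v1, GAPS C-pv09g9-15):
if `Δ_a = K + DRD* + Q*aQ` — the operator of (3.111), p. 417: *"hence the existence of a unique minimum on this hyperplane
follows from positive definiteness of the operator Δ_a"*, positive definite by Theorem 3.11, p. 416 — is positive definite,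
then so is `G⁻¹ = Δ_π + DRD* + Q*aQ`, EXACTLY: `(DRD*)A = D·R(D*A) = 0` on `{RD*A = 0}`, so `Δ_a > 0` gives
`Ginv_posDef_of_slicePos`'s hypothesis.  This — not v1's `Ginv_posDef` — is [adv8's] sharpening *"⟨A, G⁻¹A⟩ = ⟨A″, Δ_aA″⟩ +
‖RD\*A‖² ≥ 0 exactly from Δ_a > 0, with equality iff A″ = 0 and RD\*A = 0, i.e. A = 0"* made kernel.
[cite: Balaban1985BackgroundPropagators, (3.111) p.417, (3.122) p.420] -/
theorem Ginv_posDef_of_Δa [Fintype n] [Fintype m] [Fintype b] [Fintype q] [DecidableEq n] [DecidableEq m] [DecidableEq b]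
    (K : Matrix b b ℝ) (hK : Kᵀ = K) (Δ : Matrix n n ℝ) (Q : Matrix m n ℝ) (a : ℝ) (hΔ : Δ.IsSymm)
    (hΔ' : IsUnit (B9H163.Δ' Δ Q a)) (hM' : IsUnit (B9H163.M' Δ Q a)) (D : Matrix b n ℝ) (hD : Dᵀ * D = Δ)
    (Qb : Matrix q b ℝ) (Dbar : Matrix q m ℝ) (h115 : Qb * D = Dbar * Q) (ab : ℝ)
    (hΔa : (K + D * B9H163.R Δ Q a * Dᵀ + ab • (Qbᵀ * Qb)).PosDef) : (Ginv K Δ Q a D Qb ab).PosDef := by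
  refine Ginv_posDef_of_slicePos K hK Δ Q a hΔ hΔ' hM' D hD Qb Dbar h115 ab fun A hRA hA => ?_
  have h1 := hΔa.dotProduct_mulVec_pos hA
  have hz : (D * B9H163.R Δ Q a * Dᵀ) *ᵥ A = 0 := by
    rw [← mulVec_mulVec, ← mulVec_mulVec, hRA, mulVec_zero]
  rw [star_trivial, add_mulVec, add_mulVec, dotProduct_add, dotProduct_add, hz, dotProduct_zero, add_zero,
    ← dotProduct_add, ← add_mulVec] at h1
  exact h1

end GinvForm

/-! ## §5  (3.123)–(3.126): the minimum, the propagator `H = GQ*(QGQ*)⁻¹`, and the identities `RD*GQ* = 0`, `QGDR = 0` -/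

section Propagator

variable {n m τ b q κ : Type*}

/-- **p. 420, the Lagrange equations** (*"δh/δA = G⁻¹A − Q\*ω = 0, δh/δω = QA − B = 0, hence A = GQ\*ω, QGQ\*ω = B,
ω = (QGQ\*)⁻¹B, and finally A = GQ\*(QGQ\*)⁻¹B"*), for ANY nonsingular `H` (= `G⁻¹`) with `QH⁻¹Qᵀ` nonsingular:
`A⋆ := H⁻¹Qᵀ(QH⁻¹Qᵀ)⁻¹B` solves `HA⋆ = Qᵀω`, `QA⋆ = B` with `ω = (QH⁻¹Qᵀ)⁻¹B`, and `A⋆ = ℋB` with `ℋ = minOp H Q` ([an2's]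
bordered-inverse minimiser, `Beta.CompositionSingular.minOp_eq_minMap`). [cite: Balaban1985BackgroundPropagators, (3.123) p.420] -/
theorem lagrange_3123 [Fintype b] [Fintype q] [DecidableEq b] [DecidableEq q] (H : Matrix b b ℝ) (Qb : Matrix q b ℝ)
    (hH : IsUnit H.det) (hP : IsUnit (Qb * H⁻¹ * Qbᵀ).det) (B : q → ℝ) :
    H *ᵥ (H⁻¹ *ᵥ (Qbᵀ *ᵥ ((Qb * H⁻¹ * Qbᵀ)⁻¹ *ᵥ B))) = Qbᵀ *ᵥ ((Qb * H⁻¹ * Qbᵀ)⁻¹ *ᵥ B) ∧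
    Qb *ᵥ (H⁻¹ *ᵥ (Qbᵀ *ᵥ ((Qb * H⁻¹ * Qbᵀ)⁻¹ *ᵥ B))) = B ∧
    H⁻¹ *ᵥ (Qbᵀ *ᵥ ((Qb * H⁻¹ * Qbᵀ)⁻¹ *ᵥ B)) = minOp H Qb *ᵥ B := by
  refine ⟨?_, ?_, ?_⟩
  · rw [mulVec_mulVec, mul_nonsing_inv H hH, one_mulVec]
  · rw [mulVec_mulVec, mulVec_mulVec, mulVec_mulVec, mul_nonsing_inv _ hP, one_mulVec]
  · rw [minOp_eq_minMap H Qb hH hP, mulVec_mulVec, mulVec_mulVec]; rfl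

/-- **(3.123), the weight**: on the fibre `Q_bA = B` the density of the last member of (3.121) is the `G⁻¹`-Gaussian up to
the fibre constant `e^{½a‖B‖²}` ((3.122)), which cancels in the normalised mean `HB`.
[cite: Balaban1985BackgroundPropagators, (3.121)-(3.123) pp.419-420] -/
theorem eq_3123_weight [Fintype n] [Fintype m] [Fintype b] [Fintype q] [DecidableEq n] [DecidableEq m] [DecidableEq b]
    (K : Matrix b b ℝ) (Δ : Matrix n n ℝ) (Q : Matrix m n ℝ) (a : ℝ) (D : Matrix b n ℝ) (Qb : Matrix q b ℝ) (ab : ℝ)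
    (A : b → ℝ) (B : q → ℝ) (hB : Qb *ᵥ A = B) :
    Real.exp (-(1/2 : ℝ) * (A ⬝ᵥ piOp K Δ Q a D *ᵥ A) - (1/2 : ℝ) * (A ⬝ᵥ (D * B9H163.R Δ Q a * Dᵀ) *ᵥ A)) =
      Real.exp ((1/2 : ℝ) * (ab * (B ⬝ᵥ B))) * Real.exp (-(1/2 : ℝ) * (A ⬝ᵥ Ginv K Δ Q a D Qb ab *ᵥ A)) := by
  have h := eq_3122 K Δ Q a D Qb ab A B hB
  rw [add_mulVec, dotProduct_add] at h
  rw [← Real.exp_add]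
  congr 1
  linarith

/-- **(3.123) AT MEASURE LEVEL**: the normalised mean of the field `A − DG′RD*A = TA` under `δ(Q_bA − B)e^{−½⟨A,G⁻¹A⟩}dA`
— the fibre `{Q_bA = B}`, `B = Q_bA₀`, parametrised by a kernel basis `N_b` of `Q_b` — is `T` of the constrained MINIMISER
`ℋB`: `∫ e^{−½⟨A,G⁻¹A⟩}·TA = (∫ e^{−½⟨A,G⁻¹A⟩}) · (ℋB − DG′RD*ℋB)`, `ℋ = minOp G⁻¹ Q_b` (`= GQ*(QGQ*)⁻¹`,
`lagrange_3123`/`eq_3126`) — *"Making in the last integral in (3.121) a translation to this minimum we get HB = … =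
GQ\*(QGQ\*)⁻¹B − DG′RD\*GQ\*(QGQ\*)⁻¹B. (3.123)"* (§1 `constrainedMean_map`; hypothesis: `G⁻¹` positive definite on
`N(Q_b)`, e.g. by `Ginv_posDef`). [cite: Balaban1985BackgroundPropagators, (3.123) p.420] -/
theorem eq_3123 [Fintype n] [Fintype m] [Fintype b] [Fintype q] [Fintype κ] [DecidableEq n] [DecidableEq m]
    [DecidableEq b] [DecidableEq q] [DecidableEq κ] (eb : b ≃ κ ⊕ q)
    (K : Matrix b b ℝ) (hK : Kᵀ = K) (Δ : Matrix n n ℝ) (Q : Matrix m n ℝ) (a : ℝ) (hΔ : Δ.IsSymm) (D : Matrix b n ℝ)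
    (Qb : Matrix q b ℝ) (ab : ℝ) (Nb : Matrix b κ ℝ) (hQNb : Qb * Nb = 0) (hNbA : IsUnit (Nbᵀ * Nb).det)
    (hQbM : IsUnit (Qb * Qbᵀ).det) (hpos : (Nbᵀ * Ginv K Δ Q a D Qb ab * Nb).PosDef) (A₀ : b → ℝ) :
    ∫ z : κ → ℝ, Real.exp (-(1/2 : ℝ) * ((A₀ + Nb *ᵥ z) ⬝ᵥ Ginv K Δ Q a D Qb ab *ᵥ (A₀ + Nb *ᵥ z))) •
        (tOp Δ Q a D *ᵥ (A₀ + Nb *ᵥ z)) =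
      (∫ z : κ → ℝ, Real.exp (-(1/2 : ℝ) * ((A₀ + Nb *ᵥ z) ⬝ᵥ Ginv K Δ Q a D Qb ab *ᵥ (A₀ + Nb *ᵥ z)))) •
        (minOp (Ginv K Δ Q a D Qb ab) Qb *ᵥ (Qb *ᵥ A₀) -
          D *ᵥ (B9H163.G' Δ Q a *ᵥ (B9H163.R Δ Q a *ᵥ (Dᵀ *ᵥ (minOp (Ginv K Δ Q a D Qb ab) Qb *ᵥ (Qb *ᵥ A₀)))))) := by
  rw [constrainedMean_map eb (Ginv K Δ Q a D Qb ab) (Ginv_transpose K hK Δ Q a hΔ D Qb ab) Qb Nb hQNb hNbA hQbM hpos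
    (tOp Δ Q a D) A₀, tOp_mulVec]

/-- `G⁻¹` in [an2's] three-block shape `K + QᵀaQ + τᵀAτ` of `Beta.GaugeFixingPropagators`: `DRD* = τ₀ᵀ(NᵀΔ²N)⁻¹τ₀` with
the SLICE `τ₀ := NᵀΔD*` (a full-row-rank replacement of the rank-deficient `RD*`: `R = ΔN(NᵀΔ²N)⁻¹NᵀΔ`, [g13's]
`B9SectECov.R_eq_kernelBasis`) and `Q*aQ = Q_bᵀ(a·1)Q_b`. [cite: Balaban1985BackgroundPropagators, (3.122) p.420] -/
theorem Ginv_eq_slice [Fintype n] [Fintype m] [Fintype τ] [Fintype b] [Fintype q] [DecidableEq n] [DecidableEq m]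
    [DecidableEq τ] [DecidableEq b] [DecidableEq q] (e : n ≃ τ ⊕ m)
    (K : Matrix b b ℝ) (Δ : Matrix n n ℝ) (Q : Matrix m n ℝ) (a : ℝ) (hΔ : Δ.IsSymm) (hΔ' : IsUnit (B9H163.Δ' Δ Q a))
    (N : Matrix n τ ℝ) (hQN : Q * N = 0) (hQM : IsUnit (Q * Qᵀ).det) (hTs : IsUnit (Nᵀ * (Δ * Δ) * N).det)
    (D : Matrix b n ℝ) (Qb : Matrix q b ℝ) (ab : ℝ) :
    Ginv K Δ Q a D Qb ab = piOp K Δ Q a D + Qbᵀ * (ab • (1 : Matrix q q ℝ)) * Qb +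
      (Nᵀ * Δ * Dᵀ)ᵀ * (Nᵀ * (Δ * Δ) * N)⁻¹ * (Nᵀ * Δ * Dᵀ) := by
  have hR := B9SectECov.R_eq_kernelBasis e Δ Q a hΔ hΔ' N hQN hQM hTs
  have h3 : (Nᵀ * Δ * Dᵀ)ᵀ * (Nᵀ * (Δ * Δ) * N)⁻¹ * (Nᵀ * Δ * Dᵀ) = D * B9H163.R Δ Q a * Dᵀ := by
    rw [hR, transpose_mul, transpose_mul, transpose_transpose, transpose_transpose, hΔ.eq]
    simp only [Matrix.mul_assoc]
  rw [h3, Matrix.mul_smul, Matrix.mul_one, Matrix.smul_mul, Ginv, add_right_comm]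

/-- **(3.124)**: `RD*GQ* = 0` and `QGDR = 0` (`G = (G⁻¹)⁻¹`) — [an2's] bordered-matrix identities
`Beta.GaugeFixingPropagators.slice_mul_inv_mul_transpose` / `mul_inv_mul_slice_transpose` (`τ(K + QᵀaQ + τᵀAτ)⁻¹Qᵀ = 0`,
`Q(…)⁻¹τᵀ = 0` whenever `K`, `Kᵀ`, `Q` kill the gauge modes `W` and `τW`, `A` are nonsingular) BY NAME, with `K = Δ_π`,
`W = DN` (`Δ_πDN = 0`: `piOp_mul_gauge`; `Q_bDN = D̄Q′N = 0`: (3.115)), `τ = τ₀ = NᵀΔD*` (`τ₀W = NᵀΔ²N`).  The print's own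
proof is the Gaussian-integral computation (3.125) (*"similar to the proof of the corresponding identities (2.34) in [4]"*).
[cite: Balaban1985BackgroundPropagators, (3.124) p.420] -/
theorem eq_3124 [Fintype n] [Fintype m] [Fintype τ] [Fintype b] [Fintype q] [DecidableEq n] [DecidableEq m]
    [DecidableEq τ] [DecidableEq b] [DecidableEq q] (e : n ≃ τ ⊕ m)
    (K : Matrix b b ℝ) (Δ : Matrix n n ℝ) (Q : Matrix m n ℝ) (a : ℝ) (hΔ : Δ.IsSymm) (hΔ' : IsUnit (B9H163.Δ' Δ Q a))
    (N : Matrix n τ ℝ) (hQN : Q * N = 0) (hQM : IsUnit (Q * Qᵀ).det) (hTs : IsUnit (Nᵀ * (Δ * Δ) * N).det)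
    (D : Matrix b n ℝ) (hD : Dᵀ * D = Δ) (Qb : Matrix q b ℝ) (Dbar : Matrix q m ℝ) (h115 : Qb * D = Dbar * Q) (ab : ℝ)
    (hG : IsUnit (Ginv K Δ Q a D Qb ab).det) :
    B9H163.R Δ Q a * Dᵀ * (Ginv K Δ Q a D Qb ab)⁻¹ * Qbᵀ = 0 ∧
    Qb * (Ginv K Δ Q a D Qb ab)⁻¹ * (D * B9H163.R Δ Q a) = 0 := by
  have hR := B9SectECov.R_eq_kernelBasis e Δ Q a hΔ hΔ' N hQN hQM hTs
  have hslice := Ginv_eq_slice e K Δ Q a hΔ hΔ' N hQN hQM hTs D Qb ab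
  have hKW := piOp_mul_gauge K Δ Q a hΔ' N hQN D hD
  have hQW : Qb * (D * N) = 0 := by rw [← Matrix.mul_assoc, h115, Matrix.mul_assoc, hQN, Matrix.mul_zero]
  have hT : IsUnit (Nᵀ * Δ * Dᵀ * (D * N)).det := by
    have : Nᵀ * Δ * Dᵀ * (D * N) = Nᵀ * (Δ * Δ) * N := by
      rw [← hD]; simp only [Matrix.mul_assoc]
    rw [this]; exact hTs
  have hA : IsUnit ((Nᵀ * (Δ * Δ) * N)⁻¹).det := isUnit_nonsing_inv_det _ hTs
  have hG' : IsUnit (piOp K Δ Q a D + Qbᵀ * (ab • (1 : Matrix q q ℝ)) * Qb +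
      (Nᵀ * Δ * Dᵀ)ᵀ * (Nᵀ * (Δ * Δ) * N)⁻¹ * (Nᵀ * Δ * Dᵀ)).det := by rw [← hslice]; exact hG
  have h1 := Beta.GaugeFixingPropagators.slice_mul_inv_mul_transpose (piOp K Δ Q a D) Qb (Nᵀ * Δ * Dᵀ) (D * N)
    ((Nᵀ * (Δ * Δ) * N)⁻¹) (ab • (1 : Matrix q q ℝ)) hKW.1 hKW.2 hQW hT hA hG'
  have h2 := Beta.GaugeFixingPropagators.mul_inv_mul_slice_transpose (piOp K Δ Q a D) Qb (Nᵀ * Δ * Dᵀ) (D * N)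
    ((Nᵀ * (Δ * Δ) * N)⁻¹) (ab • (1 : Matrix q q ℝ)) hKW.1 hKW.2 hQW hT hA hG'
  rw [← hslice] at h1 h2
  refine ⟨?_, ?_⟩
  · have hRD : B9H163.R Δ Q a * Dᵀ = Δ * N * (Nᵀ * (Δ * Δ) * N)⁻¹ * (Nᵀ * Δ * Dᵀ) := by
      rw [hR]; simp only [Matrix.mul_assoc]
    rw [hRD, Matrix.mul_assoc _ (Nᵀ * Δ * Dᵀ), Matrix.mul_assoc _ (Nᵀ * Δ * Dᵀ * (Ginv K Δ Q a D Qb ab)⁻¹), h1,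
      Matrix.mul_zero]
  · have hDR : D * B9H163.R Δ Q a = (Nᵀ * Δ * Dᵀ)ᵀ * ((Nᵀ * (Δ * Δ) * N)⁻¹ * Nᵀ * Δ) := by
      rw [hR, transpose_mul, transpose_mul, transpose_transpose, transpose_transpose, hΔ.eq]
      simp only [Matrix.mul_assoc]
    rw [hDR, ← Matrix.mul_assoc, h2, Matrix.zero_mul]

/-- **(3.125), the symmetry λ → −λ**: the centred first moment `∫dλ δ(Q′λ)e^{−½‖Δλ‖²}Δλ` vanishes (*"by the symmetries
A → −A, λ → −λ, and the presence of linear terms in A and λ only"*) — [g13's] `B9SectECov.eq_3151_mean` at source `0`.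
The `A`-integral of (3.125) is not typed (a second moment; (3.124) is certified above by the bordered-matrix algebra).
[cite: Balaban1985BackgroundPropagators, (3.125) p.420] -/
theorem eq_3125_lambda [Fintype n] [Fintype m] [Fintype τ] [DecidableEq n] [DecidableEq m] [DecidableEq τ]
    (e : n ≃ τ ⊕ m) (Δ : Matrix n n ℝ) (Q : Matrix m n ℝ) (N : Matrix n τ ℝ) (hQN : Q * N = 0)
    (hNA : IsUnit (Nᵀ * N).det) (hQM : IsUnit (Q * Qᵀ).det) (hT : (Nᵀ * (Δ * Δ) * N).PosDef) :
    ∫ z : τ → ℝ, Real.exp (-(1/2 : ℝ) * ((N *ᵥ z) ⬝ᵥ (Δ * Δ) *ᵥ (N *ᵥ z))) • (Δ *ᵥ (N *ᵥ z)) = 0 := by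
  have h := B9SectECov.eq_3151_mean e Δ Q N hQN hNA hQM hT Δ 0
  simp only [dotProduct_zero, add_zero, mulVec_zero, smul_zero] at h
  exact h

/-- **(3.126)**: `HB = GQ*(QGQ*)⁻¹B` — the second term of (3.123) vanishes by (3.124) (`RD*·ℋ = RD*GQ*(QGQ*)⁻¹ = 0`), so
the (3.123) mean `T(ℋB) = ℋB − DG′RD*ℋB` IS the minimiser `ℋB`, and `ℋ = minOp G⁻¹ Q_b = GQ_bᵀ(Q_bGQ_bᵀ)⁻¹` ([an2's]
`minOp_eq_minMap`; cf. [an2's] `Beta.GaugeFixingPropagators.inv_mul_transpose_mul_blockProp_inv`: the same operator is the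
`Q`-part of the δ-gauge minimiser of (3.112)). [cite: Balaban1985BackgroundPropagators, (3.126) p.420] -/
theorem eq_3126 [Fintype n] [Fintype m] [Fintype τ] [Fintype b] [Fintype q] [DecidableEq n] [DecidableEq m]
    [DecidableEq τ] [DecidableEq b] [DecidableEq q] (e : n ≃ τ ⊕ m)
    (K : Matrix b b ℝ) (Δ : Matrix n n ℝ) (Q : Matrix m n ℝ) (a : ℝ) (hΔ : Δ.IsSymm) (hΔ' : IsUnit (B9H163.Δ' Δ Q a))
    (N : Matrix n τ ℝ) (hQN : Q * N = 0) (hQM : IsUnit (Q * Qᵀ).det) (hTs : IsUnit (Nᵀ * (Δ * Δ) * N).det)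
    (D : Matrix b n ℝ) (hD : Dᵀ * D = Δ) (Qb : Matrix q b ℝ) (Dbar : Matrix q m ℝ) (h115 : Qb * D = Dbar * Q) (ab : ℝ)
    (hG : IsUnit (Ginv K Δ Q a D Qb ab).det) (hP : IsUnit (Qb * (Ginv K Δ Q a D Qb ab)⁻¹ * Qbᵀ).det) (B : q → ℝ) :
    tOp Δ Q a D *ᵥ (minOp (Ginv K Δ Q a D Qb ab) Qb *ᵥ B) = minOp (Ginv K Δ Q a D Qb ab) Qb *ᵥ B ∧
    minOp (Ginv K Δ Q a D Qb ab) Qb *ᵥ B =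
      (Ginv K Δ Q a D Qb ab)⁻¹ *ᵥ (Qbᵀ *ᵥ ((Qb * (Ginv K Δ Q a D Qb ab)⁻¹ * Qbᵀ)⁻¹ *ᵥ B)) := by
  have h24 := (eq_3124 e K Δ Q a hΔ hΔ' N hQN hQM hTs D hD Qb Dbar h115 ab hG).1
  have hmin : minOp (Ginv K Δ Q a D Qb ab) Qb =
      (Ginv K Δ Q a D Qb ab)⁻¹ * Qbᵀ * (Qb * (Ginv K Δ Q a D Qb ab)⁻¹ * Qbᵀ)⁻¹ :=
    minOp_eq_minMap _ Qb hG hP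
  have hRmin : B9H163.R Δ Q a * Dᵀ * minOp (Ginv K Δ Q a D Qb ab) Qb = 0 := by
    rw [hmin]; simp only [← Matrix.mul_assoc]; rw [h24, Matrix.zero_mul]
  refine ⟨?_, ?_⟩
  · rw [mulVec_mulVec, tOp, Matrix.sub_mul, Matrix.one_mul, Matrix.mul_assoc _ Dᵀ, Matrix.mul_assoc _ (B9H163.R Δ Q a),
      ← Matrix.mul_assoc (B9H163.R Δ Q a), hRmin, Matrix.mul_zero, sub_zero]
  · rw [hmin, mulVec_mulVec, mulVec_mulVec]

end Propagator

end Literature.MathematicalPhysics.QuantumFieldTheory.Balaban1983to89.B9SectDFP
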